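import Literature.NumberTheory.LFunctions.RodgersTaoHamiltonianProofs
import Mathlib.NumberTheory.Harmonic.Bounds
import HarnessLib

/-!
# Rodgers–Tao 2020, §7, Lemma 16 (= arXiv v4 Lemma 7.1): the renormalised-energy expansion —
# display (64) (RH-FREE, `t`-free) and the RH-FREE CONTENT TWIN of Lemma 16 (time-translated schema)

Topic: NumberTheory/LFunctions (trunk T-ANT). Proofs only: 0 definitions, 0 named facts.
Companion of `Literature.NumberTheory.LFunctions.RodgersTaoHamiltonian` (which TYPES §7 of
B. Rodgers, T. Tao, *The de Bruijn–Newman constant is non-negative*, Forum Math. Pi 8 (2020) e6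
= arXiv:1801.05914, as printed) and of `RodgersTaoHamiltonianProofs` (EX-FALSO records of the
§7 facts + the RH-free `ξ`-displays of Lemma 21). Cell rh-crit C3, rt-lead ruling (52)(b):
«L7.1 CONTENT TWIN».

LINE 1 — LABEL. **RH-FREE CONTENT** (a schema: the location law (50) at the time `t` is a
HYPOTHESIS, never asserted). bears_on: N-C/N-P (COLUMN 3 DBN). WHAT THIS IS NOT: an expansion
of the renormalised energy `Ẽ^I(t)` of the zeros of `H_t` at a time `t` above a real-rooted
time in terms of the classical locations `ξ_j` — RH-free bookkeeping inside Rodgers–Tao §7,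
whose printed instance `Λ/2 ≤ t ≤ 0` is VACUOUS-AS-PRINTED in the tree (`Λ ≥ 0`,
`rodgers_tao_holds`); not Lemma 16 «formalised as progress toward RH»; nothing in this file
bears on the truth of the Riemann hypothesis.

## What the source prints (FMP pp. 40–41 = arXiv:1801.05914v5 §7, TeX l. 996–1031)

> (63) `Ẽ_{jk}(t) = E_{jk}(t) − 1/|ξ_k − ξ_j|² + 2((x_k(t) − ξ_k) − (x_j(t) − ξ_j))/(ξ_k − ξ_j)³`.
> **Lemma 16.** If `I = [I₋, I₊]_{ℤ*}` is a discrete interval and `Λ/2 ≤ t ≤ 0`, then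
> `Ẽ^I(t) = (Σ_{j,k ∈ I : j ≠ k} E_{jk}(t) − 1/|ξ_k − ξ_j|²) + O(log₊^{O(1)}(|I₋| + |I₊|))`.
> *Proof.* By symmetry and the triangle inequality, we may assume without loss of generality
> that `0 ≤ I₋ ≤ I₊`; we may then assume that `I₊` is large, as the claim is trivial for `I₊`
> in the compact region `I₊ = O(1)`. By (63), it suffices to show that
> `Σ_{j,k ∈ I : j ≠ k} ((x_k(t) − ξ_k) − (x_j(t) − ξ_j))/(ξ_k − ξ_j)³ ≪ log^{O(1)} I₊`. We may
> desymmetrize the left-hand side as `2Σ_{j ∈ I}(x_j(t) − ξ_j)Σ_{k ∈ I : k ≠ j} 1/(ξ_k − ξ_j)³`.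
> By (50), it thus suffices to show that
> (64) `Σ_{j ∈ I} |Σ_{k ∈ I : k ≠ j} 1/(ξ_k − ξ_j)³| ≪ log^{O(1)} I₊`.
> Consider the inner sum. From (44), we see that the contribution to this inner sum of those
> `k` with `|k − j| ≥ j/2` (say) is `O(log^{O(1)} I₊/j²)`. For the remaining range `|k − j| < j/2`,
> we can use (45) to estimate `1/(ξ_k − ξ_j)³ = (log³ ξ_j/(4π)³)(k − j)⁻³ + O(log^{O(1)} I₊/(j(k − j)²))`,
> and so on summing we obtain `Σ_{k ∈ I : k ≠ j} (ξ_k − ξ_j)⁻³ = (log³ ξ_j/(4π)³) Σ_{k ∈ I : 0 < |k − j| < j/2}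
> (k − j)⁻³ + O(log^{O(1)} I₊/j)`. As `k ↦ 1/(k − j)` is odd around `j`, the sum on the right-hand
> side can be estimated as `O(1/max(|j − I₋|, |I₊ − j|)²)`. Using this bound, we obtain (64).

Inputs, all in the tree: (63) = `renormEnergyZ_eq_interactionEnergy_sub` (PROVED for every
`t > Λ`, `RodgersTaoHamiltonian.lean`); (44) = Lemma 8 (ii) = `RodgersTao2020.lemma31_ii_holds_record`;
(45) = Lemma 8 (iii) = `RodgersTao2020.lemma31_iii_holds` (the tree's CORRECTED form, erratum E7:
main term `4π(k − j)/log(ξ_j/4π)`; as the typed docstring of `lemma31_iii` records, every use of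
(45) in §7 — this one included — only needs a main-term coefficient independent of `k`, so the
correction is immaterial here, exactly as in print); `|ξ_k| ≤ B|k|` =
`exists_abs_classicalLocationZ_le` (from (43)); (50) enters only as a HYPOTHESIS (typed record:
`RodgersTao2020.cor33_location`).

## What this file proves (all RH-FREE; 0 definitions, 0 named facts)

* `RodgersTao2020.sum_abs_sum_inv_cube_classicalLocationZ_le` — **display (64)**, `t`-free, for
  every `[a, b]_{ℤ*}` and with the explicit exponent `3`:
  `∃ C, ∀ a b, Σ_{k ∈ [a,b]_{ℤ*}} |Σ_{j ∈ [a,b]_{ℤ*}, j ≠ k} (ξ_k − ξ_j)⁻³| ≤ C log₊³(|a| + |b|)`.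
* `rodgers_tao_renormEnergyOn_expansion_of` — **Lemma 16, CONTENT TWIN** (time-translated
  schema, pointwise in `t`): one ABSOLUTE `C ≥ 0` such that for every `t` above a real-rooted
  time (`∃ t₁ < t, H_{t₁}` real-rooted — i.e. `t > Λ`), every `B`, and every location law
  `∀ j ≥ 1, |x_j(t) − ξ_j| ≤ B log₊ ξ_j` (the INNER shape of `RodgersTao2020.cor33_location`, the
  `H2` shape of the cell's other twins), and all integers `a, b`:
  `|Ẽ^{[a,b]_{ℤ*}}(t) − Σ_{(j,k) ∈ [a,b]_{ℤ*}², j ≠ k} (E_{jk}(t) − (ξ_k − ξ_j)⁻²)| ≤ C · B · log₊⁴(|a| + |b|)`.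
* `rodgers_tao_renormEnergyOn_expansion_on` — the same on a time interval `[t₁, t₂]` above a
  real-rooted `t₀ < t₁` (house form of the P5.1/P6.1 twins).
* `rodgers_tao_renormEnergyOn_expansion_of_cor33_location` — the AS-PRINTED Lemma 16 (typed
  witness-form fact `rodgers_tao_renormEnergyOn_expansion`, exponent `A = 4`) FOLLOWS from the
  as-printed (50) (`RodgersTao2020.cor33_location`): the implication the printed proof
  establishes («By (50), it thus suffices to show (64)»). The EX-FALSO theorem
  `rodgers_tao_renormEnergyOn_expansion_holds` (`RodgersTaoHamiltonianProofs.lean`) remains the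
  discharge of record; no second `_holds` is declared.
* Helpers (namespace `RodgersTaoRenormEnergy`): elementary sums (`Σ_{m ≥ M} m⁻³ ≤ 2/M²`,
  `Σ m⁻² ≤ 2`, `Σ_{m ≤ N} m⁻¹ ≤ 1 + log N`, the two-ray cover `sum_le_sum_Icc_shift`, the
  punctured-interval reindexing `sum_Icc_erase_eq` and the odd cancellation
  `abs_sum_Icc_erase_inv_cube_le`), the algebra of `u⁻³ − v⁻³`, the two lattice comparisons
  `lattice_comparison_crude` / `lattice_comparison_fine`, the per-index bound `inner_sum_bound`
  and the total `total_sum_bound`.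

## Proof route and divergences from print

The proof is the printed one, step for step ((63) ⇒ desymmetrise ⇒ (50) ⇒ (64); (64) by (44)
on the far range `|k − j| ≥ |k|/2`, (45) on the near range `|k − j| < |k|/2`, odd cancellation of
`m ↦ m⁻³`), with these bookkeeping choices:
1. **No «`0 ≤ I₋`» normalisation.** The comparison of `(ξ_k − ξ_j)⁻³` with the lattice term
   `(ℓ_k/4π)³(k − j)⁻³`, `ℓ_k := log(ξ_{|k|}/4π)`, is run over the WHOLE punctured interval
   `[a, b] ∖ {k}` (on the far range both terms are `O(log³/|k − j|³)` by (44), so the comparison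
   costs nothing there), and the odd cancellation is then over the full punctured integer
   interval; the index `0 ∉ ℤ*` costs one extra term `1/|k|³`. Signs enter only through (45) on
   the near range (where `j, k` have the same sign), handled by the odd symmetry `ξ_{−j} = −ξ_j`
   (`lattice_comparison_fine` reflects `k ≤ −1` to `−k ≥ 1`).
2. **ERRATUM CANDIDATE (E14, PRECISION / proof-route, statement-level NONE).** The printed
   «`O(1/max(|j − I₋|, |I₊ − j|)²)`» for the odd-cancelled sum should read **min**: for `j = I₋`
   the uncancelled one-sided sum `Σ_{0 < m < j/2} m⁻³` is `≍ 1`, not `O((I₊ − j)⁻²)`. This is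
   immaterial for (64), since `Σ_{j ∈ I} min(·)⁻²`-type sums are `O(1)`
   (`Σ_k 2/(k − a + 1)² ≤ 8`); the file proves the `min` form
   (`abs_sum_Icc_erase_inv_cube_le`: `≤ 2/(k − a + 1)² + 2/(b − k + 1)²`).
3. **Explicit exponents.** The printed `log^{O(1)}` is made explicit: exponent `3` in (64)
   (`(L/4π)³·O(1)` from the lattice sums, `O(L²(1 + log N))` from the near errors — using that
   all three logarithms `log₊(|ξ_j| + |ξ_k|)`, `log ξ_{|k|}`, `ℓ_k` are within constant factors
   of each other on the near range — and `O(L³)` from the far errors, `L := log₊(2B·max(|a|,|b|))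
   ≪ log₊(|a| + |b|)`), hence exponent `4` in the twin (one more `log₊` from (50)).
4. The twin's constant is uniform in `t` and linear in the (50)-constant `B` (in print the
   implied constant depends on `Λ` only through (50)).

## References

* [RodgersTaoFMP2020] B. Rodgers, T. Tao, *The de Bruijn–Newman constant is non-negative*, Forum
  Math. Pi 8 (2020), e6, doi:10.1017/fmp.2020.6 (= arXiv:1801.05914v5): §7 p. 40 (62)–(63),
  Lemma 16 and its proof with display (64), p. 41 (= arXiv v4 Lemma 7.1, TeX l. 1009–1031);
  §3 Lemma 8 (43)–(45) p. 21; Cor. 10 (50) p. 23; §1.2 p. 7 (`ℤ*`, `log₊`, `[a,b]_{ℤ*}`).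
-/

noncomputable section

open Real Finset

namespace Literature.NumberTheory.LFunctions

namespace RodgersTaoRenormEnergy

/-! ## Elementary sums over `ℕ` -/

/-- `Σ_{m=1}^{N} 1/m² ≤ 2`. [folklore] -/
private theorem sum_Icc_inv_sq_le_two (N : ℕ) : ∑ m ∈ Icc 1 N, 1 / (m : ℝ) ^ 2 ≤ 2 := by
  have h := sum_Ioo_inv_sq_le (α := ℝ) 0 (N + 1)
  have hI : Icc 1 N = Ioo 0 (N + 1) := by
    ext m
    simp only [mem_Icc, mem_Ioo]
    omega
  rw [hI]
  norm_num at h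
  simpa [one_div] using h

/-- Tail of `Σ 1/m³`: for `M ≥ 1`, `Σ_{m=M}^{N} 1/m³ ≤ 2/M²`. [folklore] -/
private theorem sum_Icc_inv_cube_le {M : ℕ} (hM : 1 ≤ M) (N : ℕ) :
    ∑ m ∈ Icc M N, 1 / (m : ℝ) ^ 3 ≤ 2 / (M : ℝ) ^ 2 := by
  have hM0 : (0 : ℝ) < M := by exact_mod_cast hM
  have htail : ∑ m ∈ Icc M N, 1 / (m : ℝ) ^ 2 ≤ 2 / (M : ℝ) := by
    have h := sum_Ioo_inv_sq_le (α := ℝ) (M - 1) (N + 1)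
    have hI : Icc M N = Ioo (M - 1) (N + 1) := by
      ext m
      simp only [mem_Icc, mem_Ioo]
      omega
    have hcast : ((M - 1 : ℕ) : ℝ) + 1 = M := by
      rw [Nat.cast_sub hM]
      push_cast
      ring
    rw [hcast] at h
    rw [hI]
    simpa [one_div] using h
  calc ∑ m ∈ Icc M N, 1 / (m : ℝ) ^ 3
      ≤ ∑ m ∈ Icc M N, (1 / (M : ℝ)) * (1 / (m : ℝ) ^ 2) := by
        refine sum_le_sum fun m hm ↦ ?_
        have hm : (M : ℝ) ≤ m := by exact_mod_cast (mem_Icc.1 hm).1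
        have hm0 : (0 : ℝ) < m := hM0.trans_le hm
        rw [div_mul_div_comm, one_mul, div_le_div_iff₀ (by positivity) (by positivity)]
        nlinarith [mul_nonneg (sub_nonneg.2 hm) (sq_nonneg (m : ℝ))]
    _ = (1 / (M : ℝ)) * ∑ m ∈ Icc M N, 1 / (m : ℝ) ^ 2 := by rw [mul_sum]
    _ ≤ (1 / (M : ℝ)) * (2 / (M : ℝ)) := by gcongr
    _ = 2 / (M : ℝ) ^ 2 := by ring

/-- `Σ_{m=1}^{N} 1/m ≤ 1 + log N` (`N ≥ 1`; for `N = 0` both sides read `0 ≤ 1`). [folklore] -/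
private theorem sum_Icc_inv_le_one_add_log (N : ℕ) :
    ∑ m ∈ Icc 1 N, 1 / (m : ℝ) ≤ 1 + Real.log N := by
  have h := harmonic_le_one_add_log N
  rw [harmonic_eq_sum_Icc] at h
  push_cast at h
  simpa [one_div] using h

/-- Covering a finite set of integers at distance `∈ [M, N]` from `k` by the two rays `k ± m`:
for `g ≥ 0`, `Σ_{j ∈ S} g(j) ≤ Σ_{m=M}^{N} (g(k + m) + g(k − m))`. [folklore] -/
private theorem sum_le_sum_Icc_shift (S : Finset ℤ) (k : ℤ) {M N : ℕ} (g : ℤ → ℝ) (hg : ∀ j, 0 ≤ g j)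
    (hS : ∀ j ∈ S, (M : ℤ) ≤ |j - k| ∧ |j - k| ≤ N) :
    ∑ j ∈ S, g j ≤ ∑ m ∈ Icc M N, (g (k + m) + g (k - m)) := by
  classical
  rw [sum_add_distrib, ← sum_filter_add_sum_filter_not S (fun j ↦ k ≤ j) g]
  refine add_le_add ?_ ?_
  · have hsub : S.filter (fun j ↦ k ≤ j) ⊆ (Icc M N).image (fun m : ℕ ↦ k + m) := by
      intro j hj
      rw [mem_filter] at hj
      obtain ⟨hjS, hkj⟩ := hj
      obtain ⟨h1, h2⟩ := hS j hjS
      rw [abs_of_nonneg (sub_nonneg.2 hkj)] at h1 h2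
      refine mem_image.2 ⟨(j - k).toNat, ?_, ?_⟩
      · rw [mem_Icc]; constructor <;> omega
      · omega
    calc ∑ j ∈ S.filter (fun j ↦ k ≤ j), g j
        ≤ ∑ j ∈ (Icc M N).image (fun m : ℕ ↦ k + m), g j :=
          sum_le_sum_of_subset_of_nonneg hsub fun j _ _ ↦ hg j
      _ = ∑ m ∈ Icc M N, g (k + m) := by
          rw [sum_image]
          intro x _ y _ h
          simpa using h
  · have hsub : S.filter (fun j ↦ ¬ k ≤ j) ⊆ (Icc M N).image (fun m : ℕ ↦ k - m) := by
      intro j hj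
      rw [mem_filter] at hj
      obtain ⟨hjS, hkj⟩ := hj
      obtain ⟨h1, h2⟩ := hS j hjS
      rw [abs_of_neg (by omega)] at h1 h2
      refine mem_image.2 ⟨(k - j).toNat, ?_, ?_⟩
      · rw [mem_Icc]; constructor <;> omega
      · omega
    calc ∑ j ∈ S.filter (fun j ↦ ¬ k ≤ j), g j
        ≤ ∑ j ∈ (Icc M N).image (fun m : ℕ ↦ k - m), g j :=
          sum_le_sum_of_subset_of_nonneg hsub fun j _ _ ↦ hg j
      _ = ∑ m ∈ Icc M N, g (k - m) := by
          rw [sum_image]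
          intro x _ y _ h
          simpa using h

/-- The punctured integer interval `[a, b] ∖ {k}` around `k ∈ [a, b]`, re-indexed by the distance
to `k`: `Σ_{j ∈ [a,b], j ≠ k} h(k − j) = Σ_{m=1}^{k−a} h(m) + Σ_{m=1}^{b−k} h(−m)`. [folklore] -/
private theorem sum_Icc_erase_eq {a b k : ℤ} (hak : a ≤ k) (hkb : k ≤ b) (h : ℤ → ℝ) :
    ∑ j ∈ (Icc a b).erase k, h (k - j) =
      ∑ m ∈ Icc 1 (k - a).toNat, h m + ∑ m ∈ Icc 1 (b - k).toNat, h (-(m : ℤ)) := by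
  classical
  have hdecomp : (Icc a b).erase k =
      (Icc 1 (k - a).toNat).image (fun m : ℕ ↦ k - m) ∪
        (Icc 1 (b - k).toNat).image (fun m : ℕ ↦ k + m) := by
    ext j
    simp only [mem_erase, mem_Icc, mem_union, mem_image]
    constructor
    · rintro ⟨hjk, haj, hjb⟩
      rcases lt_or_gt_of_ne hjk with hlt | hgt
      · exact Or.inl ⟨(k - j).toNat, ⟨by omega, by omega⟩, by omega⟩
      · exact Or.inr ⟨(j - k).toNat, ⟨by omega, by omega⟩, by omega⟩
    · rintro (⟨m, ⟨hm1, hm2⟩, rfl⟩ | ⟨m, ⟨hm1, hm2⟩, rfl⟩)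
      · exact ⟨by omega, by omega, by omega⟩
      · exact ⟨by omega, by omega, by omega⟩
  have hdisj : Disjoint ((Icc 1 (k - a).toNat).image (fun m : ℕ ↦ k - m))
      ((Icc 1 (b - k).toNat).image (fun m : ℕ ↦ k + m)) := by
    rw [disjoint_left]
    intro j hj1 hj2
    simp only [mem_image, mem_Icc] at hj1 hj2
    obtain ⟨m, ⟨hm1, _⟩, rfl⟩ := hj1
    obtain ⟨m', ⟨hm1', _⟩, h⟩ := hj2
    omega
  rw [hdecomp, sum_union hdisj, sum_image (by intro x _ y _ h; simpa using h),
    sum_image (by intro x _ y _ h; simpa using h)]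
  congr 1
  · refine sum_congr rfl fun m _ ↦ ?_
    congr 1
    ring
  · refine sum_congr rfl fun m _ ↦ ?_
    congr 1
    ring

/-- Odd cancellation: for `k ∈ [a, b]`,
`|Σ_{j ∈ [a,b], j ≠ k} 1/(k − j)³| ≤ 2/(k − a + 1)² + 2/(b − k + 1)²` (the symmetric part of the
range cancels, `m ↦ m⁻³` being odd, and the one-sided remainder is a tail `Σ_{m > d} m⁻³ ≤ 2/(d+1)²`,
`d` the distance from `k` to the NEAREST endpoint). [cite: RodgersTaoFMP2020, §7 proof of Lemma 16, p. 41 (last display)] -/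
theorem abs_sum_Icc_erase_inv_cube_le {a b k : ℤ} (hak : a ≤ k) (hkb : k ≤ b) :
    |∑ j ∈ (Icc a b).erase k, 1 / ((k : ℝ) - j) ^ 3| ≤
      2 / ((k : ℝ) - a + 1) ^ 2 + 2 / ((b : ℝ) - k + 1) ^ 2 := by
  have hre : ∑ j ∈ (Icc a b).erase k, 1 / ((k : ℝ) - j) ^ 3 =
      ∑ j ∈ (Icc a b).erase k, (fun m : ℤ ↦ 1 / (m : ℝ) ^ 3) (k - j) := by
    refine sum_congr rfl fun j _ ↦ ?_
    push_cast
    rfl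
  rw [hre, sum_Icc_erase_eq hak hkb (fun m : ℤ ↦ 1 / (m : ℝ) ^ 3)]
  set p : ℕ := (k - a).toNat with hp
  set q : ℕ := (b - k).toNat with hq
  have hS : ∀ n : ℕ, ∑ m ∈ Icc 1 n, (fun m : ℤ ↦ 1 / (m : ℝ) ^ 3) (m : ℕ) =
      ∑ m ∈ Icc 1 n, 1 / (m : ℝ) ^ 3 := fun n ↦ by
    refine sum_congr rfl fun m _ ↦ ?_
    simp
  have hS' : ∀ n : ℕ, ∑ m ∈ Icc 1 n, (fun m : ℤ ↦ 1 / (m : ℝ) ^ 3) (-((m : ℕ) : ℤ)) =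
      -∑ m ∈ Icc 1 n, 1 / (m : ℝ) ^ 3 := fun n ↦ by
    rw [← sum_neg_distrib]
    refine sum_congr rfl fun m _ ↦ ?_
    simp only [Int.cast_neg, Int.cast_natCast]
    rw [neg_pow, show ((-1 : ℝ)) ^ 3 = -1 by norm_num]
    ring
  rw [hS, hS', ← sub_eq_add_neg]
  have hpa : ((k : ℝ) - a + 1) = (p : ℝ) + 1 := by
    have : ((p : ℕ) : ℤ) = k - a := by omega
    have h2 : (p : ℝ) = (k : ℝ) - a := by exact_mod_cast this
    rw [h2]
  have hqb : ((b : ℝ) - k + 1) = (q : ℝ) + 1 := by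
    have : ((q : ℕ) : ℤ) = b - k := by omega
    have h2 : (q : ℝ) = (b : ℝ) - k := by exact_mod_cast this
    rw [h2]
  rw [hpa, hqb]
  -- split the longer of the two sums
  have hsplit : ∀ {m n : ℕ}, m ≤ n →
      ∑ i ∈ Icc 1 n, 1 / (i : ℝ) ^ 3 - ∑ i ∈ Icc 1 m, 1 / (i : ℝ) ^ 3 =
        ∑ i ∈ Icc (m + 1) n, 1 / (i : ℝ) ^ 3 := fun {m n} hmn ↦ by
    rw [sub_eq_iff_eq_add', ← Finset.Ico_add_one_right_eq_Icc, ← Finset.Ico_add_one_right_eq_Icc,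
      ← Finset.Ico_add_one_right_eq_Icc]
    exact (sum_Ico_consecutive _ (by omega) (by omega)).symm
  have hnn : ∀ m n : ℕ, 0 ≤ ∑ i ∈ Icc m n, 1 / (i : ℝ) ^ 3 := fun m n ↦
    sum_nonneg fun i _ ↦ by positivity
  have hp1 : (0 : ℝ) < (p : ℝ) + 1 := by positivity
  have hq1 : (0 : ℝ) < (q : ℝ) + 1 := by positivity
  rcases le_or_gt q p with hqp | hpq
  · -- value = Σ_{q+1}^{p} ≥ 0
    rw [hsplit hqp, abs_of_nonneg (hnn _ _)]
    have h := sum_Icc_inv_cube_le (M := q + 1) (by omega) p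
    push_cast at h
    linarith [div_nonneg (zero_le_two) (sq_nonneg ((p : ℝ) + 1))]
  · -- value = -(Σ_{p+1}^{q}) ≤ 0
    rw [abs_sub_comm, hsplit hpq.le, abs_of_nonneg (hnn _ _)]
    have h := sum_Icc_inv_cube_le (M := p + 1) (by omega) q
    push_cast at h
    linarith [div_nonneg (zero_le_two) (sq_nonneg ((q : ℝ) + 1))]

/-! ## The algebra of `u⁻³ − v⁻³` -/

/-- `|1/u³ − 1/v³| ≤ 2/q³` when `|u|, |v| ≥ q > 0`. [folklore] -/
private theorem abs_inv_cube_sub_le_of_le_abs {u v q : ℝ} (hq : 0 < q) (hu : q ≤ |u|) (hv : q ≤ |v|) :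
    |1 / u ^ 3 - 1 / v ^ 3| ≤ 2 / q ^ 3 := by
  have h1 : |1 / u ^ 3| ≤ 1 / q ^ 3 := by
    rw [abs_div, abs_one, abs_pow]
    exact one_div_le_one_div_of_le (pow_pos hq 3) (pow_le_pow_left₀ hq.le hu 3)
  have h2 : |1 / v ^ 3| ≤ 1 / q ^ 3 := by
    rw [abs_div, abs_one, abs_pow]
    exact one_div_le_one_div_of_le (pow_pos hq 3) (pow_le_pow_left₀ hq.le hv 3)
  calc |1 / u ^ 3 - 1 / v ^ 3| ≤ |1 / u ^ 3| + |1 / v ^ 3| := abs_sub _ _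
    _ ≤ 1 / q ^ 3 + 1 / q ^ 3 := add_le_add h1 h2
    _ = 2 / q ^ 3 := by ring

/-- `|1/u³ − 1/v³| ≤ 3 δ P²/(q₁³ q₂³)` when `|u − v| ≤ δ`, `q₁ ≤ |u| ≤ P`, `q₂ ≤ |v| ≤ P`
(`1/u³ − 1/v³ = (v − u)(v² + uv + u²)/(u³v³)`). [folklore] -/
private theorem abs_inv_cube_sub_le_of_abs_sub_le {u v δ P q₁ q₂ : ℝ} (hq₁ : 0 < q₁) (hq₂ : 0 < q₂)
    (hu₁ : q₁ ≤ |u|) (hv₁ : q₂ ≤ |v|) (hu₂ : |u| ≤ P) (hv₂ : |v| ≤ P) (hδ : |u - v| ≤ δ) :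
    |1 / u ^ 3 - 1 / v ^ 3| ≤ 3 * δ * P ^ 2 / (q₁ ^ 3 * q₂ ^ 3) := by
  have hu0 : u ≠ 0 := by
    rintro rfl
    rw [abs_zero] at hu₁
    linarith
  have hv0 : v ≠ 0 := by
    rintro rfl
    rw [abs_zero] at hv₁
    linarith
  have hP : 0 ≤ P := (abs_nonneg u).trans hu₂
  have hδ0 : 0 ≤ δ := (abs_nonneg _).trans hδ
  have key : 1 / u ^ 3 - 1 / v ^ 3 = (v - u) * (v ^ 2 + u * v + u ^ 2) / (u ^ 3 * v ^ 3) := by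
    field_simp
    ring
  rw [key, abs_div, abs_mul, abs_mul, abs_pow, abs_pow,
    div_le_div_iff₀ (mul_pos (pow_pos (abs_pos.2 hu0) 3) (pow_pos (abs_pos.2 hv0) 3))
      (mul_pos (pow_pos hq₁ 3) (pow_pos hq₂ 3))]
  have h1 : |v - u| ≤ δ := by rwa [abs_sub_comm]
  have h2 : |v ^ 2 + u * v + u ^ 2| ≤ 3 * P ^ 2 := by
    calc |v ^ 2 + u * v + u ^ 2| ≤ |v ^ 2| + |u * v| + |u ^ 2| := abs_add_three _ _ _
      _ = |v| ^ 2 + |u| * |v| + |u| ^ 2 := by rw [abs_pow, abs_mul, abs_pow]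
      _ ≤ P ^ 2 + P * P + P ^ 2 := by
          gcongr
      _ = 3 * P ^ 2 := by ring
  have h3 : q₁ ^ 3 * q₂ ^ 3 ≤ |u| ^ 3 * |v| ^ 3 :=
    mul_le_mul (pow_le_pow_left₀ hq₁.le hu₁ 3) (pow_le_pow_left₀ hq₂.le hv₁ 3)
      (pow_pos hq₂ 3).le (pow_nonneg (abs_nonneg u) 3)
  have h12 : |v - u| * |v ^ 2 + u * v + u ^ 2| ≤ δ * (3 * P ^ 2) :=
    mul_le_mul h1 h2 (abs_nonneg _) hδ0
  calc |v - u| * |v ^ 2 + u * v + u ^ 2| * (q₁ ^ 3 * q₂ ^ 3)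
      ≤ δ * (3 * P ^ 2) * (|u| ^ 3 * |v| ^ 3) :=
        mul_le_mul h12 h3 (mul_pos (pow_pos hq₁ 3) (pow_pos hq₂ 3)).le
          (mul_nonneg hδ0 (by positivity))
    _ = 3 * δ * P ^ 2 * (|u| ^ 3 * |v| ^ 3) := by ring


/-! ## The classical locations on `ℤ*`: sign bookkeeping -/

/-- `|ξ_k| = ξ_{|k|}` for `k ∈ ℤ*`. [cite: RodgersTaoFMP2020, §3 after eq. (42) p. 21] -/
theorem abs_classicalLocationZ {k : ℤ} (hk : k ≠ 0) :
    |classicalLocationZ k| = classicalLocation (k.natAbs : ℝ) := by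
  rw [classicalLocationZ_eq, abs_mul]
  have hpos : 0 < classicalLocation (k.natAbs : ℝ) :=
    classicalLocation_pos (by
      have : (0 : ℝ) ≤ (k.natAbs : ℝ) := Nat.cast_nonneg _
      linarith)
  rw [abs_of_pos hpos]
  rcases lt_or_gt_of_ne hk with h | h
  · rw [Int.sign_eq_neg_one_of_neg h]; simp
  · rw [Int.sign_eq_one_of_pos h]; simp

/-- For `k ≥ 1`: `ξ_k = ξ_{|k|}` and `(|k| : ℝ) = k`. [cite: RodgersTaoFMP2020, §3 after eq. (42) p. 21] -/
theorem classicalLocationZ_of_pos {k : ℤ} (hk : 0 < k) :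
    classicalLocationZ k = classicalLocation (k.natAbs : ℝ) := by
  rw [classicalLocationZ_eq, Int.sign_eq_one_of_pos hk]
  simp

/-- `(|k| : ℝ) = |(k : ℝ)|`. [folklore] -/
private theorem natAbs_cast_eq_abs (k : ℤ) : ((k.natAbs : ℕ) : ℝ) = |(k : ℝ)| := by
  rw [Nat.cast_natAbs, Int.cast_abs]

/-! ## The lattice comparison `(ξ_k − ξ_j)⁻³ ↔ (log(ξ_{|k|}/4π)/4π)³ (k − j)⁻³` -/

/-- CRUDE COMPARISON (all pairs; used on the far range `|k − j| ≥ |k|/2`), from the lower half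
of (44): `|(ξ_k − ξ_j)⁻³ − (ℓ_k/4π)³(k − j)⁻³| ≤ 2L³/(c³|k − j|³)` whenever
`log₊(|ξ_j| + |ξ_k|) ≤ L` and `ℓ_k = log(ξ_{|k|}/4π) ≤ L` (`0 < c ≤ 1` the constant of (44)).
[cite: RodgersTaoFMP2020, §7 proof of Lemma 16, p. 41 («From (44) we see that the contribution … of those k with |k − j| ≥ j/2 is O(log^{O(1)} I₊/j²)»)] -/
theorem lattice_comparison_crude {c : ℝ} (hc : 0 < c) (hc1 : c ≤ 1)
    (h44 : ∀ j k : ℤ, j ≠ 0 → k ≠ 0 →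
      c * (|(k : ℝ) - j| / logPlus (|classicalLocationZ j| + |classicalLocationZ k|)) ≤
        |classicalLocationZ k - classicalLocationZ j|)
    {L : ℝ} {k j : ℤ} (hk : k ≠ 0) (hj : j ≠ 0) (hjk : j ≠ k)
    (hΛL : logPlus (|classicalLocationZ j| + |classicalLocationZ k|) ≤ L)
    (hℓL : Real.log (classicalLocation (k.natAbs : ℝ) / (4 * π)) ≤ L) :
    |1 / (classicalLocationZ k - classicalLocationZ j) ^ 3 -
        (Real.log (classicalLocation (k.natAbs : ℝ) / (4 * π)) / (4 * π)) ^ 3 /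
          ((k : ℝ) - j) ^ 3| ≤
      2 * L ^ 3 / (c ^ 3 * |(k : ℝ) - j| ^ 3) := by
  set ℓ : ℝ := Real.log (classicalLocation (k.natAbs : ℝ) / (4 * π)) with hℓ_def
  set Λ : ℝ := logPlus (|classicalLocationZ j| + |classicalLocationZ k|) with hΛ_def
  set m : ℝ := |(k : ℝ) - j| with hm_def
  have hk1 : (1 : ℝ) ≤ (k.natAbs : ℝ) := by
    have : 1 ≤ k.natAbs := Int.natAbs_pos.2 hk
    exact_mod_cast this
  have hℓ1 : 1 < ℓ := RodgersTao2020.one_lt_log_classicalLocation_div hk1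
  have hℓ0 : 0 < ℓ := by linarith
  have hL0 : 0 < L := by linarith
  have hΛ0 : 0 < Λ := logPlus_pos _
  have hm0 : 0 < m := by
    rw [hm_def, abs_pos, sub_ne_zero]
    exact_mod_cast hjk.symm
  have hπ : 0 < 4 * π := by positivity
  set v : ℝ := 4 * π * ((k : ℝ) - j) / ℓ with hv_def
  have hkj : ((k : ℝ) - j) ≠ 0 := sub_ne_zero.2 (by exact_mod_cast hjk.symm)
  have hv3 : (ℓ / (4 * π)) ^ 3 / ((k : ℝ) - j) ^ 3 = 1 / v ^ 3 := by
    rw [hv_def]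
    field_simp
  rw [hv3]
  -- lower bounds `c m/L ≤ |u|, |v|`
  have hq : 0 < c * m / L := by positivity
  have hu : c * m / L ≤ |classicalLocationZ k - classicalLocationZ j| := by
    calc c * m / L ≤ c * m / Λ := by
          rw [div_le_div_iff₀ hL0 hΛ0]
          exact mul_le_mul_of_nonneg_left hΛL (by positivity)
      _ = c * (m / Λ) := by ring
      _ ≤ _ := h44 j k hj hk
  have hv : c * m / L ≤ |v| := by
    have habs : |v| = 4 * π * m / ℓ := by
      rw [hv_def, abs_div, abs_mul, abs_of_pos hπ, abs_of_pos hℓ0]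
    rw [habs, div_le_div_iff₀ hL0 hℓ0]
    have h1 : c * m * ℓ ≤ 1 * m * L := by
      have := mul_le_mul hc1 hℓL hℓ0.le zero_le_one
      nlinarith [hm0.le]
    have h2 : 1 * m * L ≤ 4 * π * m * L := by
      have : (1 : ℝ) ≤ 4 * π := by nlinarith [Real.pi_gt_three]
      nlinarith [mul_pos hm0 hL0]
    linarith
  calc |1 / (classicalLocationZ k - classicalLocationZ j) ^ 3 - 1 / v ^ 3|
      ≤ 2 / (c * m / L) ^ 3 := abs_inv_cube_sub_le_of_le_abs hq hu hv
    _ = 2 * L ^ 3 / (c ^ 3 * m ^ 3) := by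
        field_simp

/-- FINE COMPARISON on the near range, positive indices: for `k ≥ 1` and `0 < |k − j| < k/2`
(so `j ≥ 1`, `j ≍ k`), from (44) (both halves) and the corrected (45) (tree: E7 form with main
term `4π(k − j)/log(ξ_k/4π)`):
`|(ξ_k − ξ_j)⁻³ − (ℓ_k/4π)³(k − j)⁻³| ≤ K₄ ℓ_k²/(|k|(k − j)²)`,
`K₄ = 3A·max(C,4π)²·(log(2 + 3B) + 8)³/((4π)³c³)` (`c, C` from (44), `A` from (45) with
comparability constant `2`, `|ξ_k| ≤ B|k|`).
[cite: RodgersTaoFMP2020, §7 proof of Lemma 16, p. 41 («For the remaining range |k − j| < j/2, we can use (45) to estimate 1/(ξ_k − ξ_j)³ = (log³ξ_j/(4π)³)(k − j)⁻³ + O(log^{O(1)} I₊/(j(k − j)²))»)] -/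
theorem lattice_comparison_fine_pos {c C A B : ℝ} (hc : 0 < c) (hcC : c ≤ C) (hA : 0 ≤ A)
    (hB1 : 1 ≤ B)
    (h44 : ∀ j k : ℤ, j ≠ 0 → k ≠ 0 →
      c * (|(k : ℝ) - j| / logPlus (|classicalLocationZ j| + |classicalLocationZ k|)) ≤
          |classicalLocationZ k - classicalLocationZ j| ∧
        |classicalLocationZ k - classicalLocationZ j| ≤
          C * (|(k : ℝ) - j| / logPlus (|classicalLocationZ j| + |classicalLocationZ k|)))
    (h45 : ∀ j k : ℝ, 1 ≤ j → 1 ≤ k → j ≤ 2 * k → k ≤ 2 * j →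
      |classicalLocation k - classicalLocation j -
          4 * π * (k - j) / Real.log (classicalLocation j / (4 * π))| ≤
        A * ((k - j) ^ 2 / (j * Real.log (classicalLocation j) ^ 2)))
    (hB : ∀ k : ℤ, |classicalLocationZ k| ≤ B * |(k : ℝ)|)
    {k j : ℤ} (hk : 0 < k) (hjk : j ≠ k) (hnear : 2 * |k - j| < |k|) :
    |1 / (classicalLocationZ k - classicalLocationZ j) ^ 3 -
        (Real.log (classicalLocation (k.natAbs : ℝ) / (4 * π)) / (4 * π)) ^ 3 /
          ((k : ℝ) - j) ^ 3| ≤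
      (3 * A * max C (4 * π) ^ 2 * (Real.log (2 + 3 * B) + 8) ^ 3 / ((4 * π) ^ 3 * c ^ 3)) *
        (Real.log (classicalLocation (k.natAbs : ℝ) / (4 * π)) ^ 2 /
          (|(k : ℝ)| * ((k : ℝ) - j) ^ 2)) := by
  -- integer bookkeeping: `j ≥ 1`, `k ≤ 2j`, `j ≤ 2k`
  have hkabs : |k| = k := abs_of_pos hk
  have h1 : k - j ≤ |k - j| := le_abs_self _
  have h2 : -(k - j) ≤ |k - j| := neg_le_abs _
  have hj : 0 < j := by omega
  have hk2j : k ≤ 2 * j := by omega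
  have hj2k : j ≤ 2 * k := by omega
  -- real casts
  have hkR : ((k.natAbs : ℕ) : ℝ) = (k : ℝ) := by
    rw [natAbs_cast_eq_abs, abs_of_pos (by exact_mod_cast hk)]
  have hjR : ((j.natAbs : ℕ) : ℝ) = (j : ℝ) := by
    rw [natAbs_cast_eq_abs, abs_of_pos (by exact_mod_cast hj)]
  have hkR1 : (1 : ℝ) ≤ (k : ℝ) := by exact_mod_cast hk
  have hjR1 : (1 : ℝ) ≤ (j : ℝ) := by exact_mod_cast hj
  have hkR0 : (0 : ℝ) < (k : ℝ) := by linarith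
  have hξk : classicalLocationZ k = classicalLocation (k : ℝ) := by
    rw [classicalLocationZ_of_pos hk, hkR]
  have hξj : classicalLocationZ j = classicalLocation (j : ℝ) := by
    rw [classicalLocationZ_of_pos hj, hjR]
  rw [hkR, abs_of_pos hkR0]
  set ξk : ℝ := classicalLocation (k : ℝ) with hξk_def
  set ξj : ℝ := classicalLocation (j : ℝ) with hξj_def
  set ℓ : ℝ := Real.log (ξk / (4 * π)) with hℓ_def
  have hπ : 0 < 4 * π := by positivity
  have hξk0 : 0 < ξk := classicalLocation_pos (by linarith)
  have hξj0 : 0 < ξj := classicalLocation_pos (by linarith)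
  have hℓ1 : 1 < ℓ := RodgersTao2020.one_lt_log_classicalLocation_div hkR1
  have hℓ0 : 0 < ℓ := by linarith
  -- `log ξ_k = ℓ + log 4π ≤ ℓ + 3`, `ℓ ≤ log ξ_k`
  have hlogξk : Real.log ξk = ℓ + Real.log (4 * π) := by
    rw [hℓ_def, Real.log_div hξk0.ne' hπ.ne']
    ring
  have hlog4π := RodgersTao2020.log_four_pi_lt_three
  have hlog4π0 : 0 < Real.log (4 * π) := Real.log_pos (by nlinarith [Real.pi_gt_three])
  have hℓ_le_log : ℓ ≤ Real.log ξk := by linarith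
  -- the (44) log: `Λ = log₊(ξ_j + ξ_k)`, `ℓ ≤ Λ ≤ K₃ ℓ`
  set Λ : ℝ := logPlus (|classicalLocationZ j| + |classicalLocationZ k|) with hΛ_def
  have hΛ_eq : Λ = Real.log (2 + (ξj + ξk)) := by
    rw [hΛ_def, hξk, hξj, abs_of_pos hξj0, abs_of_pos hξk0, logPlus_eq,
      abs_of_nonneg (by positivity)]
  have hΛ0 : 0 < Λ := logPlus_pos _
  have hℓΛ : ℓ ≤ Λ := by
    calc ℓ ≤ Real.log ξk := hℓ_le_log
      _ ≤ Real.log (2 + (ξj + ξk)) := Real.log_le_log hξk0 (by linarith)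
      _ = Λ := hΛ_eq.symm
  set K₃ : ℝ := Real.log (2 + 3 * B) + 8 with hK₃_def
  have hlogB : 0 ≤ Real.log (2 + 3 * B) := Real.log_nonneg (by linarith)
  have hK₃0 : 0 < K₃ := by positivity
  have hΛK : Λ ≤ K₃ * ℓ := by
    -- `2 + ξ_j + ξ_k ≤ 2 + 3Bk ≤ (2 + 3B) k`, `log k ≤ 2 log ξ_k ≤ 2ℓ + 6`
    have hsum : ξj + ξk ≤ 3 * B * (k : ℝ) := by
      have h1 := hB j
      have h2 := hB k
      rw [hξj, abs_of_pos hξj0, abs_of_pos (by exact_mod_cast hj : (0 : ℝ) < j)] at h1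
      rw [hξk, abs_of_pos hξk0, abs_of_pos hkR0] at h2
      have : (j : ℝ) ≤ 2 * (k : ℝ) := by exact_mod_cast hj2k
      nlinarith
    have hle : 2 + (ξj + ξk) ≤ (2 + 3 * B) * (k : ℝ) := by nlinarith
    have hlogk : Real.log (k : ℝ) ≤ 2 * Real.log ξk := by
      have hsq := RodgersTao2020.le_classicalLocation_sq hkR1
      rw [← Real.log_rpow hξk0, Real.rpow_two]
      exact Real.log_le_log hkR0 hsq
    calc Λ = Real.log (2 + (ξj + ξk)) := hΛ_eq
      _ ≤ Real.log ((2 + 3 * B) * (k : ℝ)) := Real.log_le_log (by positivity) hle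
      _ = Real.log (2 + 3 * B) + Real.log (k : ℝ) :=
          Real.log_mul (by positivity) hkR0.ne'
      _ ≤ Real.log (2 + 3 * B) * ℓ + (2 * ℓ + 6) := by
          have : Real.log (2 + 3 * B) * 1 ≤ Real.log (2 + 3 * B) * ℓ :=
            mul_le_mul_of_nonneg_left hℓ1.le hlogB
          linarith
      _ ≤ K₃ * ℓ := by rw [hK₃_def]; nlinarith
  -- the data for the generic comparison
  set m : ℝ := |(k : ℝ) - j| with hm_def
  have hkj : ((k : ℝ) - j) ≠ 0 := sub_ne_zero.2 (by exact_mod_cast hjk.symm)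
  have hm0 : 0 < m := by rw [hm_def]; exact abs_pos.2 hkj
  have hmsq : m ^ 2 = ((k : ℝ) - j) ^ 2 := by rw [hm_def, sq_abs]
  set v : ℝ := 4 * π * ((k : ℝ) - j) / ℓ with hv_def
  have hv3 : (ℓ / (4 * π)) ^ 3 / ((k : ℝ) - j) ^ 3 = 1 / v ^ 3 := by
    rw [hv_def]
    field_simp
  have hvabs : |v| = 4 * π * m / ℓ := by
    rw [hv_def, abs_div, abs_mul, abs_of_pos hπ, abs_of_pos hℓ0]
  obtain ⟨h44l, h44u⟩ := h44 j k hj.ne' hk.ne'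
  have hC0 : 0 ≤ C := hc.le.trans hcC
  set K : ℝ := max C (4 * π) with hK_def
  have hK0 : 0 < K := lt_max_of_lt_right hπ
  -- δ
  have hδ : |(classicalLocationZ k - classicalLocationZ j) - v| ≤ A * m ^ 2 / ((k : ℝ) * ℓ ^ 2) := by
    have h := h45 (k : ℝ) (j : ℝ) hkR1 hjR1 (by exact_mod_cast hk2j) (by exact_mod_cast hj2k)
    have heq : (classicalLocationZ k - classicalLocationZ j) - v =
        -(ξj - ξk - 4 * π * ((j : ℝ) - k) / ℓ) := by
      rw [hξk, hξj, hv_def]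
      ring
    rw [heq, abs_neg]
    refine h.trans ?_
    have hjk2 : ((j : ℝ) - k) ^ 2 = m ^ 2 := by rw [hmsq]; ring
    rw [hjk2]
    have hlog0 : 0 < Real.log ξk := by linarith
    calc A * (m ^ 2 / ((k : ℝ) * Real.log ξk ^ 2))
        ≤ A * (m ^ 2 / ((k : ℝ) * ℓ ^ 2)) := by
          apply mul_le_mul_of_nonneg_left _ hA
          apply div_le_div_of_nonneg_left (by positivity) (by positivity)
          exact mul_le_mul_of_nonneg_left (pow_le_pow_left₀ hℓ0.le hℓ_le_log 2) hkR0.le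
      _ = A * m ^ 2 / ((k : ℝ) * ℓ ^ 2) := by ring
  -- q₁, q₂, P
  have hq₁ : 0 < c * m / (K₃ * ℓ) := by positivity
  have hq₂ : 0 < 4 * π * m / ℓ := by positivity
  have hu₁ : c * m / (K₃ * ℓ) ≤ |classicalLocationZ k - classicalLocationZ j| := by
    calc c * m / (K₃ * ℓ) ≤ c * m / Λ := by
          apply div_le_div_of_nonneg_left (by positivity) hΛ0 hΛK
      _ = c * (m / Λ) := by ring
      _ ≤ _ := h44l
  have hv₁ : 4 * π * m / ℓ ≤ |v| := hvabs.symm.le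
  have hu₂ : |classicalLocationZ k - classicalLocationZ j| ≤ K * m / ℓ := by
    calc |classicalLocationZ k - classicalLocationZ j| ≤ C * (m / Λ) := h44u
      _ ≤ C * (m / ℓ) := by
          apply mul_le_mul_of_nonneg_left _ hC0
          exact div_le_div_of_nonneg_left hm0.le hℓ0 hℓΛ
      _ ≤ K * (m / ℓ) := mul_le_mul_of_nonneg_right (le_max_left _ _) (by positivity)
      _ = K * m / ℓ := by ring
  have hv₂ : |v| ≤ K * m / ℓ := by
    rw [hvabs]
    exact div_le_div_of_nonneg_right (mul_le_mul_of_nonneg_right (le_max_right _ _) hm0.le)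
      hℓ0.le
  have hmain := abs_inv_cube_sub_le_of_abs_sub_le hq₁ hq₂ hu₁ hv₁ hu₂ hv₂ hδ
  rw [hv3]
  refine hmain.trans (le_of_eq ?_)
  rw [← hmsq]
  field_simp

/-- FINE COMPARISON on the near range, both signs (the `ℤ*`-odd symmetry `ξ_{−j} = −ξ_j` reduces
`k ≤ −1` to `−k ≥ 1`). [cite: RodgersTaoFMP2020, §7 proof of Lemma 16, p. 41] -/
theorem lattice_comparison_fine {c C A B : ℝ} (hc : 0 < c) (hcC : c ≤ C) (hA : 0 ≤ A)
    (hB1 : 1 ≤ B)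
    (h44 : ∀ j k : ℤ, j ≠ 0 → k ≠ 0 →
      c * (|(k : ℝ) - j| / logPlus (|classicalLocationZ j| + |classicalLocationZ k|)) ≤
          |classicalLocationZ k - classicalLocationZ j| ∧
        |classicalLocationZ k - classicalLocationZ j| ≤
          C * (|(k : ℝ) - j| / logPlus (|classicalLocationZ j| + |classicalLocationZ k|)))
    (h45 : ∀ j k : ℝ, 1 ≤ j → 1 ≤ k → j ≤ 2 * k → k ≤ 2 * j →
      |classicalLocation k - classicalLocation j -
          4 * π * (k - j) / Real.log (classicalLocation j / (4 * π))| ≤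
        A * ((k - j) ^ 2 / (j * Real.log (classicalLocation j) ^ 2)))
    (hB : ∀ k : ℤ, |classicalLocationZ k| ≤ B * |(k : ℝ)|)
    {k j : ℤ} (hk : k ≠ 0) (hjk : j ≠ k) (hnear : 2 * |k - j| < |k|) :
    |1 / (classicalLocationZ k - classicalLocationZ j) ^ 3 -
        (Real.log (classicalLocation (k.natAbs : ℝ) / (4 * π)) / (4 * π)) ^ 3 /
          ((k : ℝ) - j) ^ 3| ≤
      (3 * A * max C (4 * π) ^ 2 * (Real.log (2 + 3 * B) + 8) ^ 3 / ((4 * π) ^ 3 * c ^ 3)) *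
        (Real.log (classicalLocation (k.natAbs : ℝ) / (4 * π)) ^ 2 /
          (|(k : ℝ)| * ((k : ℝ) - j) ^ 2)) := by
  rcases lt_or_gt_of_ne hk with hneg | hpos
  · -- reflect: apply the positive case to `(−k, −j)`
    have h := lattice_comparison_fine_pos hc hcC hA hB1 h44 h45 hB (k := -k) (j := -j)
      (by omega) (by omega) (by rwa [show -k - -j = -(k - j) by ring, abs_neg, abs_neg])
    rw [Int.natAbs_neg, Int.cast_neg, Int.cast_neg, abs_neg, classicalLocationZ_neg,
      classicalLocationZ_neg] at h
    have e1 : (-classicalLocationZ k - -classicalLocationZ j) ^ 3 =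
        -((classicalLocationZ k - classicalLocationZ j) ^ 3) := by ring
    have e2 : (-(k : ℝ) - -(j : ℝ)) ^ 3 = -(((k : ℝ) - j) ^ 3) := by ring
    have e3 : (-(k : ℝ) - -(j : ℝ)) ^ 2 = ((k : ℝ) - j) ^ 2 := by ring
    rw [e1, e2, e3, div_neg, div_neg, neg_sub_neg, abs_sub_comm] at h
    exact h
  · exact lattice_comparison_fine_pos hc hcC hA hB1 h44 h45 hB hpos hjk hnear


/-! ## Display (64): the inner sums `Σ_{j ∈ I, j ≠ k} (ξ_k − ξ_j)⁻³` and their total -/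

/-- `[a, b]_{ℤ*} ∖ {k} = ([a, b] ∖ {k}) ∖ {0}`. [cite: RodgersTaoFMP2020, §1.2 p. 7] -/
theorem zstarIcc_erase_eq (a b k : ℤ) :
    (zstarIcc a b).erase k = ((Icc a b).erase k).erase 0 := by
  ext j
  simp only [mem_erase, mem_zstarIcc, mem_Icc]
  tauto

/-- PER-INDEX BOUND for (64): if every term of the inner sum is within `K₄ ℓ_k²/(|k|(k − j)²)`
of the lattice term on the near range and within `D L³/|k − j|³` of it everywhere, then
`|Σ_{j ∈ I∖{k}} (ξ_k − ξ_j)⁻³| ≤ (L/4π)³(2/(k − a + 1)² + 2/(b − k + 1)² + 1/|k|³) + 4K₄L²/|k| + 16DL³/k²`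
(odd cancellation of the lattice sum over the punctured interval; the index `0 ∉ ℤ*` costs
`1/|k|³`). [cite: RodgersTaoFMP2020, §7 proof of Lemma 16, p. 41 (display (64) and the three displays after it)] -/
theorem inner_sum_bound {a b k : ℤ} (hk : k ∈ zstarIcc a b) {L K₄ D : ℝ} (hK₄ : 0 ≤ K₄)
    (hD : 0 ≤ D) (hℓL : Real.log (classicalLocation (k.natAbs : ℝ) / (4 * π)) ≤ L)
    (hfine : ∀ j ∈ (zstarIcc a b).erase k, 2 * |k - j| < |k| →
      |1 / (classicalLocationZ k - classicalLocationZ j) ^ 3 -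
          (Real.log (classicalLocation (k.natAbs : ℝ) / (4 * π)) / (4 * π)) ^ 3 /
            ((k : ℝ) - j) ^ 3| ≤
        K₄ * (Real.log (classicalLocation (k.natAbs : ℝ) / (4 * π)) ^ 2 /
          (|(k : ℝ)| * ((k : ℝ) - j) ^ 2)))
    (hcrude : ∀ j ∈ (zstarIcc a b).erase k,
      |1 / (classicalLocationZ k - classicalLocationZ j) ^ 3 -
          (Real.log (classicalLocation (k.natAbs : ℝ) / (4 * π)) / (4 * π)) ^ 3 /
            ((k : ℝ) - j) ^ 3| ≤ D * L ^ 3 / |(k : ℝ) - j| ^ 3) :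
    |∑ j ∈ (zstarIcc a b).erase k, 1 / (classicalLocationZ k - classicalLocationZ j) ^ 3| ≤
      (L / (4 * π)) ^ 3 *
          (2 / ((k : ℝ) - a + 1) ^ 2 + 2 / ((b : ℝ) - k + 1) ^ 2 + 1 / |(k : ℝ)| ^ 3) +
        4 * K₄ * L ^ 2 / |(k : ℝ)| + 16 * D * L ^ 3 / (k : ℝ) ^ 2 := by
  obtain ⟨hk0, hak, hkb⟩ := mem_zstarIcc.1 hk
  set ℓ : ℝ := Real.log (classicalLocation (k.natAbs : ℝ) / (4 * π)) with hℓ_def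
  set S : Finset ℤ := (zstarIcc a b).erase k with hS_def
  have hk1 : (1 : ℝ) ≤ (k.natAbs : ℝ) := by
    have : 1 ≤ k.natAbs := Int.natAbs_pos.2 hk0
    exact_mod_cast this
  have hℓ1 : 1 < ℓ := RodgersTao2020.one_lt_log_classicalLocation_div hk1
  have hℓ0 : 0 ≤ ℓ := by linarith
  have hL0 : 0 ≤ L := by linarith
  have hπ : 0 < 4 * π := by positivity
  have hkR0 : (0 : ℝ) < |(k : ℝ)| := abs_pos.2 (by exact_mod_cast hk0)
  have hmemS : ∀ j ∈ S, j ≠ k ∧ j ≠ 0 ∧ a ≤ j ∧ j ≤ b := fun j hj ↦ by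
    have h := mem_erase.1 hj
    have h' := mem_zstarIcc.1 h.2
    exact ⟨h.1, h'.1, h'.2.1, h'.2.2⟩
  -- term = lattice term + error
  set latt : ℤ → ℝ := fun j ↦ (ℓ / (4 * π)) ^ 3 / ((k : ℝ) - j) ^ 3 with hlatt_def
  set err : ℤ → ℝ := fun j ↦ 1 / (classicalLocationZ k - classicalLocationZ j) ^ 3 - latt j
    with herr_def
  have hsplit : ∑ j ∈ S, 1 / (classicalLocationZ k - classicalLocationZ j) ^ 3 =
      ∑ j ∈ S, latt j + ∑ j ∈ S, err j := by
    rw [← sum_add_distrib]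
    refine sum_congr rfl fun j _ ↦ ?_
    simp only [herr_def]
    ring
  -- the lattice sum: odd cancellation
  have hmain : |∑ j ∈ S, latt j| ≤ (L / (4 * π)) ^ 3 *
      (2 / ((k : ℝ) - a + 1) ^ 2 + 2 / ((b : ℝ) - k + 1) ^ 2 + 1 / |(k : ℝ)| ^ 3) := by
    have hfac : ∑ j ∈ S, latt j = (ℓ / (4 * π)) ^ 3 * ∑ j ∈ S, 1 / ((k : ℝ) - j) ^ 3 := by
      rw [mul_sum]
      refine sum_congr rfl fun j _ ↦ ?_
      simp only [hlatt_def]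
      ring
    have hsumS : |∑ j ∈ S, 1 / ((k : ℝ) - j) ^ 3| ≤
        2 / ((k : ℝ) - a + 1) ^ 2 + 2 / ((b : ℝ) - k + 1) ^ 2 + 1 / |(k : ℝ)| ^ 3 := by
      have hT := abs_sum_Icc_erase_inv_cube_le hak hkb
      have h0k : |1 / ((k : ℝ) - ((0 : ℤ) : ℝ)) ^ 3| = 1 / |(k : ℝ)| ^ 3 := by
        rw [Int.cast_zero, sub_zero, abs_div, abs_one, abs_pow]
      rw [hS_def, zstarIcc_erase_eq]
      by_cases h0 : (0 : ℤ) ∈ (Icc a b).erase k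
      · have hadd := sum_erase_add ((Icc a b).erase k) (fun j : ℤ ↦ 1 / ((k : ℝ) - j) ^ 3) h0
        rw [eq_sub_of_add_eq hadd]
        calc |∑ j ∈ (Icc a b).erase k, 1 / ((k : ℝ) - j) ^ 3 - 1 / ((k : ℝ) - ((0 : ℤ) : ℝ)) ^ 3|
            ≤ |∑ j ∈ (Icc a b).erase k, 1 / ((k : ℝ) - j) ^ 3| +
                |1 / ((k : ℝ) - ((0 : ℤ) : ℝ)) ^ 3| := abs_sub _ _
          _ ≤ _ := by rw [h0k]; exact add_le_add hT le_rfl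
      · rw [erase_eq_of_notMem h0]
        exact hT.trans (le_add_of_nonneg_right (by positivity))
    rw [hfac, abs_mul, abs_of_nonneg (by positivity)]
    exact mul_le_mul (pow_le_pow_left₀ (by positivity) (div_le_div_of_nonneg_right hℓL hπ.le) 3)
      hsumS (abs_nonneg _) (by positivity)
  -- the error terms, near range
  set N : ℕ := (b - a).toNat with hN_def
  have hnear : ∑ j ∈ S.filter (fun j ↦ 2 * |k - j| < |k|), |err j| ≤
      4 * K₄ * L ^ 2 / |(k : ℝ)| := by
    set g : ℤ → ℝ := fun j ↦ K₄ * L ^ 2 / (|(k : ℝ)| * ((k : ℝ) - j) ^ 2) with hg_def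
    have hg : ∀ j, 0 ≤ g j := fun j ↦ by positivity
    calc ∑ j ∈ S.filter (fun j ↦ 2 * |k - j| < |k|), |err j|
        ≤ ∑ j ∈ S.filter (fun j ↦ 2 * |k - j| < |k|), g j := by
          refine sum_le_sum fun j hj ↦ ?_
          rw [mem_filter] at hj
          refine (hfine j hj.1 hj.2).trans ?_
          simp only [hg_def]
          rw [mul_div_assoc]
          refine mul_le_mul_of_nonneg_left ?_ hK₄
          exact div_le_div_of_nonneg_right (pow_le_pow_left₀ hℓ0 hℓL 2) (by positivity)
      _ ≤ ∑ m ∈ Icc 1 N, (g (k + m) + g (k - m)) := by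
          refine sum_le_sum_Icc_shift _ k g hg fun j hj ↦ ?_
          obtain ⟨hjk, -, haj, hjb⟩ := hmemS j (mem_filter.1 hj).1
          refine ⟨?_, abs_le.2 ⟨by omega, by omega⟩⟩
          exact_mod_cast Int.one_le_abs (sub_ne_zero.2 hjk)
      _ = ∑ m ∈ Icc 1 N, (2 * (K₄ * L ^ 2 / |(k : ℝ)|)) * (1 / (m : ℝ) ^ 2) := by
          refine sum_congr rfl fun m hm ↦ ?_
          have e1 : ((k : ℝ) - ((k + (m : ℤ) : ℤ) : ℝ)) ^ 2 = (m : ℝ) ^ 2 := by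
            push_cast
            ring
          have e2 : ((k : ℝ) - ((k - (m : ℤ) : ℤ) : ℝ)) ^ 2 = (m : ℝ) ^ 2 := by
            push_cast
            ring
          simp only [hg_def]
          rw [e1, e2]
          ring
      _ = (2 * (K₄ * L ^ 2 / |(k : ℝ)|)) * ∑ m ∈ Icc 1 N, 1 / (m : ℝ) ^ 2 := by
          rw [mul_sum]
      _ ≤ (2 * (K₄ * L ^ 2 / |(k : ℝ)|)) * 2 := by
          gcongr
          exact sum_Icc_inv_sq_le_two N
      _ = 4 * K₄ * L ^ 2 / |(k : ℝ)| := by ring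
  -- the error terms, far range
  have hfar : ∑ j ∈ S.filter (fun j ↦ ¬ 2 * |k - j| < |k|), |err j| ≤
      16 * D * L ^ 3 / (k : ℝ) ^ 2 := by
    set g : ℤ → ℝ := fun j ↦ D * L ^ 3 / |(k : ℝ) - j| ^ 3 with hg_def
    have hg : ∀ j, 0 ≤ g j := fun j ↦ by positivity
    set M : ℕ := (k.natAbs + 1) / 2 with hM_def
    have hM1 : 1 ≤ M := by
      have : 1 ≤ k.natAbs := Int.natAbs_pos.2 hk0
      omega
    have hM2 : k.natAbs ≤ 2 * M := by omega
    have hMR : |(k : ℝ)| ≤ 2 * (M : ℝ) := by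
      rw [← natAbs_cast_eq_abs]
      exact_mod_cast hM2
    have hMR0 : (0 : ℝ) < M := by exact_mod_cast hM1
    have hkabs : ((k.natAbs : ℕ) : ℤ) = |k| := Int.natCast_natAbs k
    calc ∑ j ∈ S.filter (fun j ↦ ¬ 2 * |k - j| < |k|), |err j|
        ≤ ∑ j ∈ S.filter (fun j ↦ ¬ 2 * |k - j| < |k|), g j :=
          sum_le_sum fun j hj ↦ hcrude j (mem_filter.1 hj).1
      _ ≤ ∑ m ∈ Icc M N, (g (k + m) + g (k - m)) := by
          refine sum_le_sum_Icc_shift _ k g hg fun j hj ↦ ?_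
          obtain ⟨hjS, hfarj⟩ := mem_filter.1 hj
          obtain ⟨hjk, -, haj, hjb⟩ := hmemS j hjS
          rw [not_lt, abs_sub_comm] at hfarj
          have h1 : j - k ≤ |j - k| := le_abs_self _
          have h2 : -(j - k) ≤ |j - k| := neg_le_abs _
          have h3 : k ≤ |k| := le_abs_self _
          have h4 : -k ≤ |k| := neg_le_abs _
          refine ⟨?_, abs_le.2 ⟨by omega, by omega⟩⟩
          push_cast [hM_def]
          omega
      _ = ∑ m ∈ Icc M N, (2 * (D * L ^ 3)) * (1 / (m : ℝ) ^ 3) := by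
          refine sum_congr rfl fun m hm ↦ ?_
          have hm0 : (0 : ℝ) ≤ (m : ℝ) := Nat.cast_nonneg m
          have e1 : |(k : ℝ) - ((k + m : ℤ) : ℝ)| = m := by
            push_cast
            rw [show (k : ℝ) - (k + m) = -(m : ℝ) by ring, abs_neg, abs_of_nonneg hm0]
          have e2 : |(k : ℝ) - ((k - m : ℤ) : ℝ)| = m := by
            push_cast
            rw [show (k : ℝ) - (k - m) = (m : ℝ) by ring, abs_of_nonneg hm0]
          simp only [hg_def]
          rw [e1, e2]
          ring
      _ = (2 * (D * L ^ 3)) * ∑ m ∈ Icc M N, 1 / (m : ℝ) ^ 3 := by rw [mul_sum]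
      _ ≤ (2 * (D * L ^ 3)) * (2 / (M : ℝ) ^ 2) := by
          gcongr
          exact sum_Icc_inv_cube_le hM1 N
      _ ≤ (2 * (D * L ^ 3)) * (8 / (k : ℝ) ^ 2) := by
          gcongr 2 * (D * L ^ 3) * ?_
          rw [div_le_div_iff₀ (by positivity) (by positivity)]
          have : (k : ℝ) ^ 2 = |(k : ℝ)| ^ 2 := (sq_abs _).symm
          rw [this]
          nlinarith [hMR, hkR0]
      _ = 16 * D * L ^ 3 / (k : ℝ) ^ 2 := by ring
  have herr : ∑ j ∈ S, |err j| ≤ 4 * K₄ * L ^ 2 / |(k : ℝ)| + 16 * D * L ^ 3 / (k : ℝ) ^ 2 := by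
    rw [← sum_filter_add_sum_filter_not S (fun j ↦ 2 * |k - j| < |k|)]
    exact add_le_add hnear hfar
  rw [hsplit]
  calc |∑ j ∈ S, latt j + ∑ j ∈ S, err j|
      ≤ |∑ j ∈ S, latt j| + |∑ j ∈ S, err j| := abs_add_le _ _
    _ ≤ |∑ j ∈ S, latt j| + ∑ j ∈ S, |err j| := by
        gcongr
        exact abs_sum_le_sum_abs _ _
    _ ≤ _ := by linarith [hmain, herr]

/-- TOTAL for (64): summing the per-index bounds over `k ∈ [a, b]_{ℤ*}`
(`Σ 2/(k − a + 1)² ≤ 8`, `Σ 2/(b − k + 1)² ≤ 8`, `Σ 1/|k|³ ≤ 4`, `Σ 1/|k| ≤ 2(1 + log N) ≤ 4L`,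
`Σ 1/k² ≤ 4`, `(4π)³ ≥ 20`): the total is at most `(1 + 16K₄ + 64D) L³`.
[cite: RodgersTaoFMP2020, §7 proof of Lemma 16, p. 41 («Using this bound we obtain (64)»)] -/
theorem total_sum_bound {a b : ℤ} {L K₄ D : ℝ} (hL1 : 1 ≤ L) (hK₄ : 0 ≤ K₄) (hD : 0 ≤ D)
    (hlogN : Real.log (max |(a : ℝ)| |(b : ℝ)|) ≤ L) {F : ℤ → ℝ}
    (hinner : ∀ k ∈ zstarIcc a b, |F k| ≤
      (L / (4 * π)) ^ 3 *
          (2 / ((k : ℝ) - a + 1) ^ 2 + 2 / ((b : ℝ) - k + 1) ^ 2 + 1 / |(k : ℝ)| ^ 3) +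
        4 * K₄ * L ^ 2 / |(k : ℝ)| + 16 * D * L ^ 3 / (k : ℝ) ^ 2) :
    ∑ k ∈ zstarIcc a b, |F k| ≤ (1 + 16 * K₄ + 64 * D) * L ^ 3 := by
  set I : Finset ℤ := zstarIcc a b with hI_def
  set N : ℕ := (b - a).toNat + 1 with hN_def
  set N₀ : ℕ := max a.natAbs b.natAbs with hN₀_def
  have hL0 : 0 ≤ L := by linarith
  have hπ : 0 < 4 * π := by positivity
  have hmemI : ∀ k ∈ I, k ≠ 0 ∧ a ≤ k ∧ k ≤ b := fun k hk ↦ mem_zstarIcc.1 hk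
  have haabs : ((a.natAbs : ℕ) : ℤ) = |a| := Int.natCast_natAbs a
  have hbabs : ((b.natAbs : ℕ) : ℤ) = |b| := Int.natCast_natAbs b
  have ha1 : a ≤ |a| := le_abs_self a
  have ha2 : -a ≤ |a| := neg_le_abs a
  have hb1 : b ≤ |b| := le_abs_self b
  have hb2 : -b ≤ |b| := neg_le_abs b
  -- (1) Σ 2/(k − a + 1)²  ≤ 8
  have h1 : ∑ k ∈ I, 2 / ((k : ℝ) - a + 1) ^ 2 ≤ 8 := by
    set g : ℤ → ℝ := fun j ↦ 2 / ((j : ℝ) - a + 1) ^ 2 with hg_def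
    calc ∑ k ∈ I, 2 / ((k : ℝ) - a + 1) ^ 2 = ∑ k ∈ I, g k := rfl
      _ ≤ ∑ m ∈ Icc 1 N, (g (a - 1 + m) + g (a - 1 - m)) := by
          refine sum_le_sum_Icc_shift I (a - 1) g (fun j ↦ by positivity) fun k hk ↦ ?_
          obtain ⟨-, hak, hkb⟩ := hmemI k hk
          rw [abs_of_nonneg (by omega)]
          push_cast [hN_def]
          constructor <;> omega
      _ = ∑ m ∈ Icc 1 N, 4 * (1 / (m : ℝ) ^ 2) := by
          refine sum_congr rfl fun m hm ↦ ?_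
          have hm0 : (m : ℝ) ≠ 0 := by
            have : 1 ≤ m := (mem_Icc.1 hm).1
            positivity
          simp only [hg_def]
          push_cast
          rw [show (a : ℝ) - 1 + m - a + 1 = m by ring, show (a : ℝ) - 1 - m - a + 1 = -m by ring,
            neg_sq]
          ring
      _ = 4 * ∑ m ∈ Icc 1 N, 1 / (m : ℝ) ^ 2 := by rw [mul_sum]
      _ ≤ 4 * 2 := by gcongr; exact sum_Icc_inv_sq_le_two N
      _ = 8 := by norm_num
  -- (2) Σ 2/(b − k + 1)² ≤ 8
  have h2 : ∑ k ∈ I, 2 / ((b : ℝ) - k + 1) ^ 2 ≤ 8 := by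
    set g : ℤ → ℝ := fun j ↦ 2 / ((b : ℝ) - j + 1) ^ 2 with hg_def
    calc ∑ k ∈ I, 2 / ((b : ℝ) - k + 1) ^ 2 = ∑ k ∈ I, g k := rfl
      _ ≤ ∑ m ∈ Icc 1 N, (g (b + 1 + m) + g (b + 1 - m)) := by
          refine sum_le_sum_Icc_shift I (b + 1) g (fun j ↦ by positivity) fun k hk ↦ ?_
          obtain ⟨-, hak, hkb⟩ := hmemI k hk
          rw [abs_of_nonpos (by omega)]
          push_cast [hN_def]
          constructor <;> omega
      _ = ∑ m ∈ Icc 1 N, 4 * (1 / (m : ℝ) ^ 2) := by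
          refine sum_congr rfl fun m hm ↦ ?_
          have hm0 : (m : ℝ) ≠ 0 := by
            have : 1 ≤ m := (mem_Icc.1 hm).1
            positivity
          simp only [hg_def]
          push_cast
          rw [show (b : ℝ) - (b + 1 + m) + 1 = -m by ring, show (b : ℝ) - (b + 1 - m) + 1 = m by ring,
            neg_sq]
          ring
      _ = 4 * ∑ m ∈ Icc 1 N, 1 / (m : ℝ) ^ 2 := by rw [mul_sum]
      _ ≤ 4 * 2 := by gcongr; exact sum_Icc_inv_sq_le_two N
      _ = 8 := by norm_num
  -- membership of `k ∈ I` relative to the centre `0`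
  have hmem0 : ∀ k ∈ I, ((1 : ℕ) : ℤ) ≤ |k - 0| ∧ |k - 0| ≤ ((N₀ : ℕ) : ℤ) := fun k hk ↦ by
    obtain ⟨hk0, hak, hkb⟩ := hmemI k hk
    rw [sub_zero]
    refine ⟨by exact_mod_cast Int.one_le_abs hk0, ?_⟩
    have h3 : k ≤ |k| := le_abs_self k
    have h4 : -k ≤ |k| := neg_le_abs k
    rw [hN₀_def, Nat.cast_max, haabs, hbabs]
    rcases le_or_gt 0 k with h | h
    · rw [abs_of_nonneg h]; omega
    · rw [abs_of_neg h]; omega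
  -- (3) Σ 1/|k|³ ≤ 4
  have h3 : ∑ k ∈ I, 1 / |(k : ℝ)| ^ 3 ≤ 4 := by
    set g : ℤ → ℝ := fun j ↦ 1 / |(j : ℝ)| ^ 3 with hg_def
    calc ∑ k ∈ I, 1 / |(k : ℝ)| ^ 3 = ∑ k ∈ I, g k := rfl
      _ ≤ ∑ m ∈ Icc 1 N₀, (g (0 + m) + g (0 - m)) :=
          sum_le_sum_Icc_shift I 0 g (fun j ↦ by positivity) hmem0
      _ = ∑ m ∈ Icc 1 N₀, 2 * (1 / (m : ℝ) ^ 3) := by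
          refine sum_congr rfl fun m hm ↦ ?_
          simp only [hg_def]
          push_cast
          rw [zero_add, zero_sub, abs_neg, Nat.abs_cast]
          ring
      _ = 2 * ∑ m ∈ Icc 1 N₀, 1 / (m : ℝ) ^ 3 := by rw [mul_sum]
      _ ≤ 2 * (2 / ((1 : ℕ) : ℝ) ^ 2) := by gcongr; exact sum_Icc_inv_cube_le le_rfl N₀
      _ = 4 := by norm_num
  -- (4) Σ 1/k² ≤ 4
  have h4 : ∑ k ∈ I, 1 / (k : ℝ) ^ 2 ≤ 4 := by
    set g : ℤ → ℝ := fun j ↦ 1 / (j : ℝ) ^ 2 with hg_def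
    calc ∑ k ∈ I, 1 / (k : ℝ) ^ 2 = ∑ k ∈ I, g k := rfl
      _ ≤ ∑ m ∈ Icc 1 N₀, (g (0 + m) + g (0 - m)) :=
          sum_le_sum_Icc_shift I 0 g (fun j ↦ by positivity) hmem0
      _ = ∑ m ∈ Icc 1 N₀, 2 * (1 / (m : ℝ) ^ 2) := by
          refine sum_congr rfl fun m hm ↦ ?_
          simp only [hg_def]
          push_cast
          rw [zero_add, zero_sub, neg_sq]
          ring
      _ = 2 * ∑ m ∈ Icc 1 N₀, 1 / (m : ℝ) ^ 2 := by rw [mul_sum]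
      _ ≤ 2 * 2 := by gcongr; exact sum_Icc_inv_sq_le_two N₀
      _ = 4 := by norm_num
  -- (5) Σ 1/|k| ≤ 2(1 + log N₀) ≤ 4L
  have h5 : ∑ k ∈ I, 1 / |(k : ℝ)| ≤ 4 * L := by
    set g : ℤ → ℝ := fun j ↦ 1 / |(j : ℝ)| with hg_def
    have hN₀R : ((N₀ : ℕ) : ℝ) = max |(a : ℝ)| |(b : ℝ)| := by
      rw [hN₀_def, Nat.cast_max, natAbs_cast_eq_abs, natAbs_cast_eq_abs]
    calc ∑ k ∈ I, 1 / |(k : ℝ)| = ∑ k ∈ I, g k := rfl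
      _ ≤ ∑ m ∈ Icc 1 N₀, (g (0 + m) + g (0 - m)) :=
          sum_le_sum_Icc_shift I 0 g (fun j ↦ by positivity) hmem0
      _ = ∑ m ∈ Icc 1 N₀, 2 * (1 / (m : ℝ)) := by
          refine sum_congr rfl fun m hm ↦ ?_
          simp only [hg_def]
          push_cast
          rw [zero_add, zero_sub, abs_neg, Nat.abs_cast]
          ring
      _ = 2 * ∑ m ∈ Icc 1 N₀, 1 / (m : ℝ) := by rw [mul_sum]
      _ ≤ 2 * (1 + Real.log N₀) := by gcongr; exact sum_Icc_inv_le_one_add_log N₀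
      _ ≤ 2 * (1 + L) := by rw [hN₀R]; gcongr
      _ ≤ 4 * L := by linarith
  -- combine
  have h20 : (20 : ℝ) ≤ (4 * π) ^ 3 := by
    have h12 : (12 : ℝ) ≤ 4 * π := by linarith [Real.pi_gt_three]
    calc (20 : ℝ) ≤ 12 ^ 3 := by norm_num
      _ ≤ (4 * π) ^ 3 := pow_le_pow_left₀ (by norm_num) h12 3
  calc ∑ k ∈ I, |F k|
      ≤ ∑ k ∈ I, ((L / (4 * π)) ^ 3 *
            (2 / ((k : ℝ) - a + 1) ^ 2 + 2 / ((b : ℝ) - k + 1) ^ 2 + 1 / |(k : ℝ)| ^ 3) +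
          4 * K₄ * L ^ 2 / |(k : ℝ)| + 16 * D * L ^ 3 / (k : ℝ) ^ 2) := sum_le_sum hinner
    _ = (L / (4 * π)) ^ 3 * (∑ k ∈ I, 2 / ((k : ℝ) - a + 1) ^ 2 +
          ∑ k ∈ I, 2 / ((b : ℝ) - k + 1) ^ 2 + ∑ k ∈ I, 1 / |(k : ℝ)| ^ 3) +
        4 * K₄ * L ^ 2 * ∑ k ∈ I, 1 / |(k : ℝ)| + 16 * D * L ^ 3 * ∑ k ∈ I, 1 / (k : ℝ) ^ 2 := by
        have eX : ∑ k ∈ I, (L / (4 * π)) ^ 3 *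
              (2 / ((k : ℝ) - a + 1) ^ 2 + 2 / ((b : ℝ) - k + 1) ^ 2 + 1 / |(k : ℝ)| ^ 3) =
            (L / (4 * π)) ^ 3 * (∑ k ∈ I, 2 / ((k : ℝ) - a + 1) ^ 2 +
              ∑ k ∈ I, 2 / ((b : ℝ) - k + 1) ^ 2 + ∑ k ∈ I, 1 / |(k : ℝ)| ^ 3) := by
          rw [← mul_sum, sum_add_distrib, sum_add_distrib]
        have eY : ∑ k ∈ I, 4 * K₄ * L ^ 2 / |(k : ℝ)| = 4 * K₄ * L ^ 2 * ∑ k ∈ I, 1 / |(k : ℝ)| := by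
          rw [mul_sum]
          exact sum_congr rfl fun k _ ↦ by ring
        have eZ : ∑ k ∈ I, 16 * D * L ^ 3 / (k : ℝ) ^ 2 = 16 * D * L ^ 3 * ∑ k ∈ I, 1 / (k : ℝ) ^ 2 := by
          rw [mul_sum]
          exact sum_congr rfl fun k _ ↦ by ring
        rw [sum_add_distrib, sum_add_distrib, eX, eY, eZ]
    _ ≤ (L / (4 * π)) ^ 3 * (8 + 8 + 4) + 4 * K₄ * L ^ 2 * (4 * L) + 16 * D * L ^ 3 * 4 := by
        gcongr
    _ = L ^ 3 * (20 / (4 * π) ^ 3) + 16 * K₄ * L ^ 3 + 64 * D * L ^ 3 := by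
        field_simp
        ring
    _ ≤ L ^ 3 * 1 + 16 * K₄ * L ^ 3 + 64 * D * L ^ 3 := by
        gcongr
        rw [div_le_one (by positivity)]
        exact h20
    _ = (1 + 16 * K₄ + 64 * D) * L ^ 3 := by ring


end RodgersTaoRenormEnergy

namespace RodgersTao2020

open RodgersTaoRenormEnergy

/-- RH-FREE, CONTENT, `t`-FREE — Rodgers–Tao 2020, §7, proof of Lemma 16, **display (64)**
(FMP p. 41 = arXiv:1801.05914v5 §7 eq. (ji)): «`Σ_{j ∈ I} |Σ_{k ∈ I : k ≠ j} 1/(ξ_k − ξ_j)³| ≪ log^{O(1)} I₊`»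
for a discrete interval `I = [I₋, I₊]_{ℤ*}`, a statement about the classical locations `ξ_j`
only. Rendered for every `[a, b]_{ℤ*}` (no «`0 ≤ I₋`» normalisation) with the explicit exponent
`3`: one absolute `C` with `Σ_{k ∈ [a,b]_{ℤ*}} |Σ_{j ∈ [a,b]_{ℤ*}, j ≠ k} (ξ_k − ξ_j)⁻³| ≤ C log₊³(|a| + |b|)`.
Proof as printed ((44) on the far range `|k − j| ≥ |k|/2`, the corrected (45) — tree
`lemma31_iii_holds`, erratum E7 — on the near range, odd cancellation of `m ↦ m⁻³`), with the
lattice comparison run over the whole punctured interval (divergence announced in the module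
docstring) and the one-sided remainder of the odd cancellation estimated by
`O(1/min(|k − I₋|, |I₊ − k|)²)` (the printed «max» is a slip; see the module docstring).
[cite: RodgersTaoFMP2020, §7 proof of Lemma 16, display (64), p. 41] -/
theorem sum_abs_sum_inv_cube_classicalLocationZ_le :
    ∃ C : ℝ, 0 ≤ C ∧ ∀ a b : ℤ,
      ∑ k ∈ zstarIcc a b, |∑ j ∈ (zstarIcc a b).erase k,
          1 / (classicalLocationZ k - classicalLocationZ j) ^ 3| ≤
        C * _root_.Literature.NumberTheory.LFunctions.logPlus (|(a : ℝ)| + |(b : ℝ)|) ^ 3 := by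
  obtain ⟨c₀, C₁, hc₀, hc₀C, h44₀⟩ := lemma31_ii_holds_record
  obtain ⟨A₀, h45₀⟩ := lemma31_iii_holds 2 (by norm_num)
  obtain ⟨B₀, -, hB₀⟩ := exists_abs_classicalLocationZ_le
  -- normalised constants
  set c : ℝ := min c₀ 1 with hc_def
  have hc : 0 < c := lt_min hc₀ one_pos
  have hc1 : c ≤ 1 := min_le_right _ _
  have hcC : c ≤ C₁ := (min_le_left _ _).trans hc₀C
  have h44 : ∀ j k : ℤ, j ≠ 0 → k ≠ 0 →
      c * (|(k : ℝ) - j| / _root_.Literature.NumberTheory.LFunctions.logPlus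
          (|classicalLocationZ j| + |classicalLocationZ k|)) ≤
          |classicalLocationZ k - classicalLocationZ j| ∧
        |classicalLocationZ k - classicalLocationZ j| ≤
          C₁ * (|(k : ℝ) - j| / _root_.Literature.NumberTheory.LFunctions.logPlus
            (|classicalLocationZ j| + |classicalLocationZ k|)) := fun j k hj hk ↦
    ⟨(mul_le_mul_of_nonneg_right (min_le_left _ _)
      (div_nonneg (abs_nonneg _) (logPlus_nonneg _))).trans (h44₀ j k hj hk).1,
      (h44₀ j k hj hk).2⟩
  set A : ℝ := max A₀ 0 with hA_def
  have hA : 0 ≤ A := le_max_right _ _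
  have h45 : ∀ j k : ℝ, 1 ≤ j → 1 ≤ k → j ≤ 2 * k → k ≤ 2 * j →
      |classicalLocation k - classicalLocation j -
          4 * π * (k - j) / Real.log (classicalLocation j / (4 * π))| ≤
        A * ((k - j) ^ 2 / (j * Real.log (classicalLocation j) ^ 2)) :=
    fun j k hj hk hjk hkj ↦ (h45₀ j k hj hk hjk hkj).trans
      (mul_le_mul_of_nonneg_right (le_max_left _ _)
        (div_nonneg (sq_nonneg _) (mul_nonneg (by linarith) (sq_nonneg _))))
  set B : ℝ := max B₀ 1 with hB_def
  have hB1 : 1 ≤ B := le_max_right _ _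
  have hB0 : 0 ≤ B := zero_le_one.trans hB1
  have hB : ∀ k : ℤ, |classicalLocationZ k| ≤ B * |(k : ℝ)| := fun k ↦
    (hB₀ k).trans (mul_le_mul_of_nonneg_right (le_max_left _ _) (abs_nonneg _))
  have hlog3B : 0 ≤ Real.log (2 + 3 * B) := Real.log_nonneg (by linarith)
  set K₄ : ℝ := 3 * A * max C₁ (4 * π) ^ 2 * (Real.log (2 + 3 * B) + 8) ^ 3 /
    ((4 * π) ^ 3 * c ^ 3) with hK₄_def
  have hK₄ : 0 ≤ K₄ :=
    div_nonneg (mul_nonneg (mul_nonneg (mul_nonneg (by norm_num) hA) (sq_nonneg _))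
      (pow_nonneg (by linarith) 3)) (by positivity)
  set D : ℝ := 2 / c ^ 3 with hD_def
  have hD : 0 ≤ D := by positivity
  have hlog2 : 0 < Real.log 2 := Real.log_pos one_lt_two
  have hlog2B : 0 ≤ Real.log (2 + 2 * B) := Real.log_nonneg (by linarith)
  set K₅ : ℝ := 1 + Real.log (2 + 2 * B) / Real.log 2 with hK₅_def
  have hK₅ : 1 ≤ K₅ := le_add_of_nonneg_right (div_nonneg hlog2B hlog2.le)
  have hcoef : 0 ≤ 1 + 16 * K₄ + 64 * D := by positivity
  refine ⟨(1 + 16 * K₄ + 64 * D) * K₅ ^ 3, mul_nonneg hcoef (pow_nonneg (by linarith) 3),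
    fun a b ↦ ?_⟩
  set I : Finset ℤ := zstarIcc a b with hI_def
  set P : ℝ := _root_.Literature.NumberTheory.LFunctions.logPlus (|(a : ℝ)| + |(b : ℝ)|)
    with hP_def
  have hP0 : 0 ≤ P := logPlus_nonneg _
  rcases I.eq_empty_or_nonempty with hI | ⟨k₀, hk₀⟩
  · rw [hI, sum_empty]
    exact mul_nonneg (mul_nonneg hcoef (pow_nonneg (by linarith) 3)) (pow_nonneg hP0 3)
  -- the size `N = max(|a|, |b|) ≥ 1` and the master logarithm `L = log₊(2BN)`
  set N : ℝ := max |(a : ℝ)| |(b : ℝ)| with hN_def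
  have hmemI : ∀ k ∈ I, k ≠ 0 ∧ a ≤ k ∧ k ≤ b := fun k hk ↦ mem_zstarIcc.1 hk
  have habsI : ∀ k ∈ I, (1 : ℝ) ≤ |(k : ℝ)| ∧ |(k : ℝ)| ≤ N := fun k hk ↦ by
    obtain ⟨hk0, hak, hkb⟩ := hmemI k hk
    refine ⟨by exact_mod_cast Int.one_le_abs hk0, abs_le.2 ⟨?_, ?_⟩⟩
    · have h1 : (a : ℝ) ≤ k := by exact_mod_cast hak
      have h2 : -|(a : ℝ)| ≤ a := neg_abs_le _
      linarith [le_max_left |(a : ℝ)| |(b : ℝ)|]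
    · have h1 : (k : ℝ) ≤ b := by exact_mod_cast hkb
      have h2 : (b : ℝ) ≤ |(b : ℝ)| := le_abs_self _
      linarith [le_max_right |(a : ℝ)| |(b : ℝ)|]
  have hN1 : 1 ≤ N := (habsI k₀ hk₀).1.trans (habsI k₀ hk₀).2
  have hN0 : 0 ≤ N := zero_le_one.trans hN1
  set L : ℝ := _root_.Literature.NumberTheory.LFunctions.logPlus (2 * B * N) with hL_def
  have hBN : 0 ≤ 2 * B * N := by positivity
  have hL_eq : L = Real.log (2 + 2 * B * N) := by
    rw [hL_def, _root_.Literature.NumberTheory.LFunctions.logPlus_eq, abs_of_nonneg hBN]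
  have hL1 : 1 ≤ L := by
    have he : Real.exp 1 ≤ 2 + 2 * B * N := by
      have := Real.exp_one_lt_d9
      nlinarith
    calc (1 : ℝ) = Real.log (Real.exp 1) := (Real.log_exp 1).symm
      _ ≤ Real.log (2 + 2 * B * N) := Real.log_le_log (Real.exp_pos 1) he
      _ = L := hL_eq.symm
  have hL0 : 0 ≤ L := zero_le_one.trans hL1
  have hmonoL : ∀ x : ℝ, 0 ≤ x → x ≤ 2 * B * N →
      _root_.Literature.NumberTheory.LFunctions.logPlus x ≤ L := fun x hx hxle ↦
    logPlus_mono (by rwa [abs_of_nonneg hx, abs_of_nonneg hBN])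
  have hξI : ∀ k ∈ I, |classicalLocationZ k| ≤ B * N := fun k hk ↦
    (hB k).trans (mul_le_mul_of_nonneg_left (habsI k hk).2 hB0)
  have hΛL : ∀ j ∈ I, ∀ k ∈ I, _root_.Literature.NumberTheory.LFunctions.logPlus
      (|classicalLocationZ j| + |classicalLocationZ k|) ≤ L := fun j hj k hk ↦
    hmonoL _ (by positivity) (by linarith [hξI j hj, hξI k hk])
  have hℓL : ∀ k ∈ I, Real.log (classicalLocation (k.natAbs : ℝ) / (4 * π)) ≤ L := fun k hk ↦ by
    have hk0 := (hmemI k hk).1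
    have hk1 : (1 : ℝ) ≤ (k.natAbs : ℝ) := by
      have : 1 ≤ k.natAbs := Int.natAbs_pos.2 hk0
      exact_mod_cast this
    have hξ0 : 0 < classicalLocation (k.natAbs : ℝ) := classicalLocation_pos (by linarith)
    calc Real.log (classicalLocation (k.natAbs : ℝ) / (4 * π))
        ≤ Real.log (classicalLocation (k.natAbs : ℝ)) := log_classicalLocation_div_le hk1
      _ ≤ _root_.Literature.NumberTheory.LFunctions.logPlus (classicalLocation (k.natAbs : ℝ)) :=
          _root_.Literature.NumberTheory.LFunctions.log_le_logPlus _
      _ ≤ L := by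
          refine hmonoL _ hξ0.le ?_
          rw [← abs_classicalLocationZ hk0]
          linarith [hξI k hk, mul_nonneg hB0 hN0]
  have hlogN : Real.log (max |(a : ℝ)| |(b : ℝ)|) ≤ L := by
    calc Real.log N ≤ _root_.Literature.NumberTheory.LFunctions.logPlus N :=
          _root_.Literature.NumberTheory.LFunctions.log_le_logPlus _
      _ ≤ L := hmonoL N hN0 (by nlinarith)
  have hLK : L ≤ K₅ * P := by
    have hP_eq : P = Real.log (2 + (|(a : ℝ)| + |(b : ℝ)|)) := by
      rw [hP_def, _root_.Literature.NumberTheory.LFunctions.logPlus_eq,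
        abs_of_nonneg (by positivity)]
    have hNab : N ≤ |(a : ℝ)| + |(b : ℝ)| := max_le (le_add_of_nonneg_right (abs_nonneg _))
      (le_add_of_nonneg_left (abs_nonneg _))
    have h1 : L ≤ Real.log (2 + 2 * B) + Real.log (2 + N) := by
      rw [hL_eq, ← Real.log_mul (by positivity) (by positivity)]
      exact Real.log_le_log (by positivity) (by nlinarith)
    have h2 : Real.log (2 + N) ≤ P := by
      rw [hP_eq]
      exact Real.log_le_log (by positivity) (by linarith)
    have h3 : Real.log 2 ≤ P := _root_.Literature.NumberTheory.LFunctions.log_two_le_logPlus _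
    have h4 : Real.log (2 + 2 * B) ≤ Real.log (2 + 2 * B) / Real.log 2 * P := by
      rw [div_mul_eq_mul_div, le_div_iff₀ hlog2]
      exact mul_le_mul_of_nonneg_left h3 hlog2B
    calc L ≤ Real.log (2 + 2 * B) / Real.log 2 * P + P := by linarith
      _ = K₅ * P := by rw [hK₅_def]; ring
  -- per-index bounds
  have hinner : ∀ k ∈ I, |∑ j ∈ I.erase k, 1 / (classicalLocationZ k - classicalLocationZ j) ^ 3| ≤
      (L / (4 * π)) ^ 3 *
          (2 / ((k : ℝ) - a + 1) ^ 2 + 2 / ((b : ℝ) - k + 1) ^ 2 + 1 / |(k : ℝ)| ^ 3) +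
        4 * K₄ * L ^ 2 / |(k : ℝ)| + 16 * D * L ^ 3 / (k : ℝ) ^ 2 := fun k hk ↦ by
    have hk0 := (hmemI k hk).1
    refine inner_sum_bound hk hK₄ hD (hℓL k hk) (fun j hj hnear ↦ ?_) (fun j hj ↦ ?_)
    · exact lattice_comparison_fine hc hcC hA hB1 h44 h45 hB hk0 (mem_erase.1 hj).1 hnear
    · have hjI := (mem_erase.1 hj).2
      have hj0 := (hmemI j hjI).1
      have h := lattice_comparison_crude hc hc1 (fun j k hj hk ↦ (h44 j k hj hk).1) hk0 hj0
        (mem_erase.1 hj).1 (hΛL j hjI k hk) (hℓL k hk)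
      refine h.trans (le_of_eq ?_)
      rw [hD_def]
      ring
  have htot := total_sum_bound hL1 hK₄ hD hlogN hinner
  calc ∑ k ∈ I, |∑ j ∈ I.erase k, 1 / (classicalLocationZ k - classicalLocationZ j) ^ 3|
      ≤ (1 + 16 * K₄ + 64 * D) * L ^ 3 := htot
    _ ≤ (1 + 16 * K₄ + 64 * D) * (K₅ * P) ^ 3 :=
        mul_le_mul_of_nonneg_left (pow_le_pow_left₀ hL0 hLK 3) hcoef
    _ = (1 + 16 * K₄ + 64 * D) * K₅ ^ 3 * P ^ 3 := by ring

end RodgersTao2020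

/-! ## Lemma 16, CONTENT TWIN (time-translated schema) -/

/-- For `k ∈ ℤ*`: `|x_k(t) − ξ_k| = |x_{|k|}(t) − ξ_{|k|}|` (odd extensions).
[cite: RodgersTaoFMP2020, §1.2 p. 7] -/
theorem RodgersTaoRenormEnergy.abs_deBruijnZeroZ_sub_classicalLocationZ (t : ℝ) {k : ℤ}
    (hk : k ≠ 0) :
    |deBruijnZeroZ t k - classicalLocationZ k| =
      |deBruijnZero t k.natAbs - classicalLocation (k.natAbs : ℝ)| := by
  rcases lt_or_gt_of_ne hk with h | h
  · obtain ⟨n, hn⟩ := Int.exists_eq_neg_ofNat h.le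
    subst hn
    have hn0 : n ≠ 0 := by rintro rfl; simp at h
    rw [deBruijnZeroZ_neg_natCast, classicalLocationZ_neg, classicalLocationZ_natCast hn0,
      Int.natAbs_neg, Int.natAbs_natCast, ← abs_neg]
    congr 1
    ring
  · obtain ⟨n, hn⟩ := Int.eq_ofNat_of_zero_le h.le
    subst hn
    have hn0 : n ≠ 0 := by rintro rfl; simp at h
    rw [deBruijnZeroZ_natCast, classicalLocationZ_natCast hn0, Int.natAbs_natCast]

/-- **RH-FREE CONTENT TWIN of Rodgers–Tao 2020, Lemma 16** (= arXiv v4 Lemma 7.1; FMP p. 41),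
time-translated schema form. The printed Lemma 16 («if `I = [I₋, I₊]_{ℤ*}` is a discrete
interval and `Λ/2 ≤ t ≤ 0`, then `Ẽ^I(t) = (Σ_{j,k ∈ I : j ≠ k} E_{jk}(t) − 1/|ξ_k − ξ_j|²) +
O(log₊^{O(1)}(|I₋| + |I₊|))`») is VACUOUS-AS-PRINTED in the tree (`Λ ≥ 0`, `rodgers_tao_holds`;
typed fact `rodgers_tao_renormEnergyOn_expansion`, EX-FALSO record
`rodgers_tao_renormEnergyOn_expansion_holds`). Its printed PROOF uses the time `t` only through
two inputs: the ordering of the zeros at time `t` (for (63)), available at every `t > Λ`, and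
the location law (50) `x_j(t) = ξ_j + O(log₊ ξ_j)`. This theorem is exactly that proof with (50)
as a HYPOTHESIS at the time `t`: for one ABSOLUTE constant `C` (uniform in `t`, linear in the
(50)-constant `B`), at every time `t` above a real-rooted time and for every `B` with
`|x_j(t) − ξ_j| ≤ B log₊ ξ_j` (`j ≥ 1`),
`|Ẽ^{[a,b]_{ℤ*}}(t) − Σ_{(j,k)} (E_{jk}(t) − (ξ_k − ξ_j)⁻²)| ≤ C · B · log₊⁴(|a| + |b|)` for all
integers `a, b`. Proof: (63) (`renormEnergyZ_eq_interactionEnergy_sub`) turns the difference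
into `2Σ_{j ≠ k}((x_k − ξ_k) − (x_j − ξ_j))/(ξ_k − ξ_j)³ = 4Σ_k (x_k − ξ_k)Σ_{j ≠ k}(ξ_k − ξ_j)⁻³`
(«we may desymmetrize»), the hypothesis bounds `|x_k − ξ_k| ≤ B log₊ ξ_{|k|} ≪ B log₊(|a| + |b|)`,
and (64) (`RodgersTao2020.sum_abs_sum_inv_cube_classicalLocationZ_le`) bounds the rest. The (50)
input at times `t > Λ ≥ 0` is NOT asserted here (it is Ki–Kim–Lee 2009 Thm. 1.4 /
Polymath15 Thm. 1.5 territory); the printed instance is recovered from `RodgersTao2020.cor33_location`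
in `rodgers_tao_renormEnergyOn_expansion_of_cor33_location`. WHAT THIS IS NOT: not progress
toward RH; an RH-free expansion of a renormalised energy of the `H_t`-zeros above a real-rooted
time. [cite: RodgersTaoFMP2020, Lemma 16 p. 41 (= arXiv:1801.05914v4 Lemma 7.1), proof p. 41] -/
theorem rodgers_tao_renormEnergyOn_expansion_of :
    ∃ C : ℝ, 0 ≤ C ∧ ∀ t : ℝ, (∃ t₁ : ℝ, t₁ < t ∧ HasOnlyRealZeros (deBruijnH t₁)) →
      ∀ B : ℝ, (∀ j : ℕ, 1 ≤ j →
          |deBruijnZero t j - classicalLocation (j : ℝ)| ≤ B * logPlus (classicalLocation (j : ℝ))) →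
        ∀ a b : ℤ,
          |renormEnergyOnZ t (zstarIcc a b) -
              ∑ p ∈ (zstarIcc a b).offDiag, (interactionEnergy t p.1 p.2 -
                1 / (classicalLocationZ p.2 - classicalLocationZ p.1) ^ 2)| ≤
            C * B * logPlus (|(a : ℝ)| + |(b : ℝ)|) ^ 4 := by
  obtain ⟨C₀, hC₀, h64⟩ := RodgersTao2020.sum_abs_sum_inv_cube_classicalLocationZ_le
  obtain ⟨B₀, -, hB₀⟩ := exists_abs_classicalLocationZ_le
  set B₁ : ℝ := max B₀ 1 with hB₁_def
  have hB₁1 : 1 ≤ B₁ := le_max_right _ _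
  have hB₁0 : 0 ≤ B₁ := zero_le_one.trans hB₁1
  have hB₁ : ∀ k : ℤ, |classicalLocationZ k| ≤ B₁ * |(k : ℝ)| := fun k ↦
    (hB₀ k).trans (mul_le_mul_of_nonneg_right (le_max_left _ _) (abs_nonneg _))
  have hlog2 : 0 < Real.log 2 := Real.log_pos one_lt_two
  have hlogB : 0 ≤ Real.log (2 + B₁) := Real.log_nonneg (by linarith)
  set K₆ : ℝ := 1 + Real.log (2 + B₁) / Real.log 2 with hK₆_def
  have hK₆ : 0 ≤ K₆ := by positivity
  refine ⟨4 * C₀ * K₆, by positivity, fun t hΛ B h50 a b ↦ ?_⟩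
  set I : Finset ℤ := zstarIcc a b with hI_def
  set P : ℝ := logPlus (|(a : ℝ)| + |(b : ℝ)|) with hP_def
  have hP0 : 0 ≤ P := logPlus_nonneg _
  -- `B ≥ 0` (from the hypothesis at `j = 1`)
  have hB : 0 ≤ B := by
    have h1 := (abs_nonneg _).trans (h50 1 le_rfl)
    have h2 := logPlus_pos (classicalLocation ((1 : ℕ) : ℝ))
    nlinarith
  -- the deviations `d_k = x_k(t) − ξ_k`
  set d : ℤ → ℝ := fun k ↦ deBruijnZeroZ t k - classicalLocationZ k with hd_def
  have hmemI : ∀ k ∈ I, k ≠ 0 ∧ a ≤ k ∧ k ≤ b := fun k hk ↦ mem_zstarIcc.1 hk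
  have hd : ∀ k ∈ I, |d k| ≤ B * (K₆ * P) := fun k hk ↦ by
    obtain ⟨hk0, hak, hkb⟩ := hmemI k hk
    have hn1 : 1 ≤ k.natAbs := Int.natAbs_pos.2 hk0
    have hkabs : |(k : ℝ)| ≤ |(a : ℝ)| + |(b : ℝ)| := by
      refine abs_le.2 ⟨?_, ?_⟩
      · have h1 : (a : ℝ) ≤ k := by exact_mod_cast hak
        linarith [neg_abs_le (a : ℝ), abs_nonneg (b : ℝ)]
      · have h1 : (k : ℝ) ≤ b := by exact_mod_cast hkb
        linarith [le_abs_self (b : ℝ), abs_nonneg (a : ℝ)]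
    have hξ0 : 0 < classicalLocation (k.natAbs : ℝ) :=
      classicalLocation_pos (by have : (0 : ℝ) ≤ (k.natAbs : ℝ) := Nat.cast_nonneg _; linarith)
    have hξle : classicalLocation (k.natAbs : ℝ) ≤ B₁ * (|(a : ℝ)| + |(b : ℝ)|) := by
      rw [← RodgersTaoRenormEnergy.abs_classicalLocationZ hk0]
      exact (hB₁ k).trans (mul_le_mul_of_nonneg_left hkabs hB₁0)
    have hlogξ : logPlus (classicalLocation (k.natAbs : ℝ)) ≤ K₆ * P := by
      have hP_eq : P = Real.log (2 + (|(a : ℝ)| + |(b : ℝ)|)) := by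
        rw [hP_def, logPlus_eq, abs_of_nonneg (by positivity)]
      have h1 : logPlus (classicalLocation (k.natAbs : ℝ)) ≤
          Real.log (2 + B₁) + Real.log (2 + (|(a : ℝ)| + |(b : ℝ)|)) := by
        rw [logPlus_eq, abs_of_pos hξ0, ← Real.log_mul (by positivity) (by positivity)]
        refine Real.log_le_log (by positivity) ?_
        nlinarith [abs_nonneg (a : ℝ), abs_nonneg (b : ℝ)]
      have h3 : Real.log 2 ≤ P := log_two_le_logPlus _
      have h4 : Real.log (2 + B₁) ≤ Real.log (2 + B₁) / Real.log 2 * P := by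
        rw [div_mul_eq_mul_div, le_div_iff₀ hlog2]
        exact mul_le_mul_of_nonneg_left h3 hlogB
      calc logPlus (classicalLocation (k.natAbs : ℝ))
          ≤ Real.log (2 + B₁) / Real.log 2 * P + P := by rw [← hP_eq] at h1; linarith
        _ = K₆ * P := by rw [hK₆_def]; ring
    calc |d k| = |deBruijnZero t k.natAbs - classicalLocation (k.natAbs : ℝ)| :=
          RodgersTaoRenormEnergy.abs_deBruijnZeroZ_sub_classicalLocationZ t hk0
      _ ≤ B * logPlus (classicalLocation (k.natAbs : ℝ)) := h50 k.natAbs hn1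
      _ ≤ B * (K₆ * P) := mul_le_mul_of_nonneg_left hlogξ hB
  -- (63), termwise
  have h63 : renormEnergyOnZ t I - ∑ p ∈ I.offDiag, (interactionEnergy t p.1 p.2 -
      1 / (classicalLocationZ p.2 - classicalLocationZ p.1) ^ 2) =
      ∑ p ∈ I.offDiag, (2 * (d p.2 / (classicalLocationZ p.2 - classicalLocationZ p.1) ^ 3) -
        2 * (d p.1 / (classicalLocationZ p.2 - classicalLocationZ p.1) ^ 3)) := by
    rw [renormEnergyOnZ_eq, ← sum_sub_distrib]
    refine sum_congr rfl fun p hp ↦ ?_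
    obtain ⟨-, -, h12⟩ := mem_offDiag.1 hp
    rw [renormEnergyZ_eq_interactionEnergy_sub hΛ h12]
    simp only [hd_def]
    ring
  -- «we may desymmetrize»: the swap `(j, k) ↦ (k, j)`
  have hswap : ∑ p ∈ I.offDiag, 2 * (d p.1 / (classicalLocationZ p.2 - classicalLocationZ p.1) ^ 3) =
      ∑ p ∈ I.offDiag, -(2 * (d p.2 / (classicalLocationZ p.2 - classicalLocationZ p.1) ^ 3)) := by
    refine sum_nbij' Prod.swap Prod.swap (fun p hp ↦ ?_) (fun p hp ↦ ?_) (fun p _ ↦ by simp)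
      (fun p _ ↦ by simp) (fun p hp ↦ ?_)
    · obtain ⟨h1, h2, h12⟩ := mem_offDiag.1 hp
      exact mem_offDiag.2 ⟨h2, h1, h12.symm⟩
    · obtain ⟨h1, h2, h12⟩ := mem_offDiag.1 hp
      exact mem_offDiag.2 ⟨h2, h1, h12.symm⟩
    · obtain ⟨-, -, h12⟩ := mem_offDiag.1 hp
      have hne : classicalLocationZ p.2 - classicalLocationZ p.1 ≠ 0 :=
        classicalLocationZ_sub_ne_zero h12
      simp only [Prod.fst_swap, Prod.snd_swap]
      have : (classicalLocationZ p.1 - classicalLocationZ p.2) ^ 3 =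
          -((classicalLocationZ p.2 - classicalLocationZ p.1) ^ 3) := by ring
      rw [this, div_neg, mul_neg, neg_neg]
  -- the fibre form `Σ_k d_k · Σ_{j ≠ k} (ξ_k − ξ_j)⁻³`
  have hfib0 : ∑ p ∈ I.offDiag, d p.2 / (classicalLocationZ p.2 - classicalLocationZ p.1) ^ 3 =
      ∑ k ∈ I, d k * ∑ j ∈ I.erase k, 1 / (classicalLocationZ k - classicalLocationZ j) ^ 3 := by
    have hoff : I.offDiag = (I ×ˢ I).filter (fun p ↦ p.1 ≠ p.2) := by
      ext p
      simp only [mem_offDiag, mem_filter, mem_product, and_assoc]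
    rw [hoff, sum_filter, sum_product_right]
    refine sum_congr rfl fun k _ ↦ ?_
    rw [mul_sum, ← filter_ne', sum_filter]
    refine sum_congr rfl fun j _ ↦ ?_
    dsimp only
    split_ifs <;> ring
  have hfib : ∑ p ∈ I.offDiag, 2 * (d p.2 / (classicalLocationZ p.2 - classicalLocationZ p.1) ^ 3) =
      2 * ∑ k ∈ I, d k * ∑ j ∈ I.erase k, 1 / (classicalLocationZ k - classicalLocationZ j) ^ 3 := by
    rw [← mul_sum, hfib0]
  have hE : renormEnergyOnZ t I - ∑ p ∈ I.offDiag, (interactionEnergy t p.1 p.2 -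
      1 / (classicalLocationZ p.2 - classicalLocationZ p.1) ^ 2) =
      4 * ∑ k ∈ I, d k * ∑ j ∈ I.erase k, 1 / (classicalLocationZ k - classicalLocationZ j) ^ 3 := by
    rw [h63, sum_sub_distrib, hswap, sum_neg_distrib, sub_neg_eq_add, hfib]
    ring
  -- the estimate
  rw [hE, abs_mul, abs_of_pos (by norm_num : (0 : ℝ) < 4)]
  have hsum := h64 a b
  calc 4 * |∑ k ∈ I, d k * ∑ j ∈ I.erase k, 1 / (classicalLocationZ k - classicalLocationZ j) ^ 3|
      ≤ 4 * ∑ k ∈ I, |d k * ∑ j ∈ I.erase k, 1 / (classicalLocationZ k - classicalLocationZ j) ^ 3| := by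
        gcongr
        exact abs_sum_le_sum_abs _ _
    _ ≤ 4 * ∑ k ∈ I, (B * (K₆ * P)) *
          |∑ j ∈ I.erase k, 1 / (classicalLocationZ k - classicalLocationZ j) ^ 3| := by
        gcongr with k hk
        rw [abs_mul]
        exact mul_le_mul_of_nonneg_right (hd k hk) (abs_nonneg _)
    _ = 4 * (B * (K₆ * P)) *
          ∑ k ∈ I, |∑ j ∈ I.erase k, 1 / (classicalLocationZ k - classicalLocationZ j) ^ 3| := by
        simp only [mul_sum]
        exact sum_congr rfl fun k _ ↦ by ring
    _ ≤ 4 * (B * (K₆ * P)) * (C₀ * P ^ 3) := by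
        gcongr
    _ = 4 * C₀ * K₆ * B * P ^ 4 := by ring

/-- The same schema on a time interval `[t₁, t₂]` above a real-rooted time `t₀ < t₁` (the house
form of the cell's other time-translated twins: hypothesis (50) uniform on the interval, one
constant uniform on the interval). [cite: RodgersTaoFMP2020, Lemma 16 p. 41 (= arXiv:1801.05914v4 Lemma 7.1)] -/
theorem rodgers_tao_renormEnergyOn_expansion_on {t₀ t₁ t₂ B : ℝ} (h01 : t₀ < t₁)
    (hreal : HasOnlyRealZeros (deBruijnH t₀))
    (h50 : ∀ t ∈ Set.Icc t₁ t₂, ∀ j : ℕ, 1 ≤ j →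
      |deBruijnZero t j - classicalLocation (j : ℝ)| ≤ B * logPlus (classicalLocation (j : ℝ))) :
    ∃ C : ℝ, 0 ≤ C ∧ ∀ t ∈ Set.Icc t₁ t₂, ∀ a b : ℤ,
      |renormEnergyOnZ t (zstarIcc a b) -
          ∑ p ∈ (zstarIcc a b).offDiag, (interactionEnergy t p.1 p.2 -
            1 / (classicalLocationZ p.2 - classicalLocationZ p.1) ^ 2)| ≤
        C * logPlus (|(a : ℝ)| + |(b : ℝ)|) ^ 4 := by
  obtain ⟨C, hC0, hC⟩ := rodgers_tao_renormEnergyOn_expansion_of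
  have hB : t₁ ≤ t₂ → 0 ≤ B := fun h12 ↦ by
    have h1 := (abs_nonneg _).trans (h50 t₁ ⟨le_rfl, h12⟩ 1 le_rfl)
    have h2 := logPlus_pos (classicalLocation ((1 : ℕ) : ℝ))
    nlinarith
  refine ⟨C * max B 0, by positivity, fun t ht a b ↦ ?_⟩
  have hΛ : ∃ t' : ℝ, t' < t ∧ HasOnlyRealZeros (deBruijnH t') := ⟨t₀, by linarith [ht.1], hreal⟩
  have hB0 : 0 ≤ B := hB (ht.1.trans ht.2)
  have h := hC t hΛ B (h50 t ht) a b
  rwa [max_eq_left hB0]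

/-- The AS-PRINTED Lemma 16 FOLLOWS from (50) as printed: the typed (witness-form) fact
`rodgers_tao_renormEnergyOn_expansion` is implied by the typed `RodgersTao2020.cor33_location`
(Rodgers–Tao 2020 Cor. 10 (50)) — the implication the printed proof establishes («By (50), it
thus suffices to show (64)»), with exponent `A = 4`. (Both facts are VACUOUS-AS-PRINTED records
in the tree; this implication carries the content, the EX-FALSO discharge
`rodgers_tao_renormEnergyOn_expansion_holds` remains the discharge of record.)
[cite: RodgersTaoFMP2020, Lemma 16 p. 41 (proof: «By (50), it thus suffices to show (64)»)] -/
theorem rodgers_tao_renormEnergyOn_expansion_of_cor33_location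
    (h : RodgersTao2020.cor33_location) : rodgers_tao_renormEnergyOn_expansion := by
  intro t₀ ht₀ hreal
  obtain ⟨A, hA⟩ := h
  obtain ⟨C, -, hC⟩ := rodgers_tao_renormEnergyOn_expansion_of
  refine ⟨4, C * A, fun t ht1 ht2 a b ↦ ?_⟩
  have hΛ : ∃ t₁ : ℝ, t₁ < t ∧ HasOnlyRealZeros (deBruijnH t₁) := ⟨t₀, by linarith, hreal⟩
  have h := hC t hΛ A (fun j hj ↦ hA t hΛ ht2 j hj) a b
  rw [show (4 : ℝ) = ((4 : ℕ) : ℝ) by norm_num, Real.rpow_natCast]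
  exact h

end Literature.NumberTheory.LFunctions
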